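import Mathlib
import Summits.CriticalPhenomena.SAWScalingLimit.Theses.SAWDefectDecoherence
import Summits.CriticalPhenomena.SAWScalingLimit.Theses.SAWPhaseRetrieval
import Summits.CriticalPhenomena.SAWScalingLimit.Theorems.SAWDefectDecoherenceConjugateClassNegligibleSums
import Literature.Barriers.CriticalPhenomena.ParafermionicHalfCauchyRiemann
import Literature.Probability.RandomPlanarGeometry.HexParafermionProofs
import Summits.CriticalPhenomena.SAWScalingLimit.Theorems.SAWDefectDecoherenceHexObservableLimitRReindex
import Summits.CriticalPhenomena.SAWScalingLimit.Theorems.SAWDefectDecoherenceHexObservableLimitRGreenLimit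
import Summits.CriticalPhenomena.SAWScalingLimit.Theorems.SAWDefectDecoherenceHexObservableLimitRDensityIntegrable
import HarnessLib

/-!
# Skeleton — crux `HexObservableLimitR` (stmt-CriticalPhenomena-14003), ALTERNATIVE line
`explicit-bump-synthesis` (crux-strategist s1, 2026-08-17)

Same SAW content as the live line `Ideator1Sketch` (Green form of DCS 2012 Conjecture 2: the three
SAW stubs `stub_massBound`, `stub_twistNull`, `stub_boundaryFlux` are repeated VERBATIM — name and
signature — so one proof serves both lines and the audit of `Disproof.lean` F5 carries over), same
three LANDED helpers (`stub_reindex` p87892, `stub_greenLimit` p90531, `stub_densityIntegrable`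
p91481), same composition `HexObservableLimitR_of` with `c = 6 c'`.

What differs is the PROVABLE identification layer, where the live line has stalled (none of its six
analysis stubs — mollify, invLocallyIntegrable, cauchyPompeiu, cauchyTransform, holoOfDbar,
taylorUniform — nor its glue `cauchySynthesis_of_stubs` landed over fourteen continuation cycles).
Here the `∂̄`-primitive is EXPLICIT, the glue is PROVED IN THIS FILE (`bumpSynthesis`, Part 1,
sorry-free, ≈ 800 lines, standard axioms), and the analysis layer shrinks to TWO elementary,
crux-independent stubs:

* `stub_bumpPrimitive`  — ONE explicit pair `(B, Θ)`: `Θ ∈ C³(ℂ)`, `∂̄Θ = B` pointwise, `B ∈ C³`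
  supported in the closed unit disc with `∫ B ≠ 0`, and `Θ z = m / z` for `‖z‖ ≥ 1`
  (take `Θ := (1 - φ) · z⁻¹`, `φ` a smooth radial bump `≡ 1` near `0` inside `ball 0 1`; then
  `B := ∂̄Θ = -(∂̄φ)/z` is smooth and `∫ B = π`: polar coordinates, or Green on a rectangle).
* `stub_bumpApproximation` — finite sums `Σ_w c_w B((z-w)/s)` of small dilated translates of ANY
  `B ∈ C_c(ℂ)` with `∫ B ≠ 0` approximate every `ψ ∈ C_c(ℂ)` uniformly, centres in `tsupport ψ`
  (normalised mollification + Riemann sums; uniform continuity only).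

So the skeleton's `sorry`s are EXACTLY THE THREE SAW STUBS: the whole identification layer
(`stub_bumpPrimitive` Part 1b, `stub_bumpApproximation` Part 1c, the glue `bumpSynthesis` Part 1)
is PROVED in this file, and `HexObservableLimitR_of` is kernel-checked from the SAW stubs alone.

PART 1 (generic, Mathlib only; namespace `…Cruxes.HexObservableLimitR.ExplicitBump`): `∂̄`-calculus
(`dbar_*`), the geometric-series Taylor polynomial `geomTaylor` of `1/(z-w)` with its remainder
bound, the dilated-translated family (`bumpSum`, `primSum`, `tailSum`, `taylorSum`:
`∂̄ primSum = bumpSum`, `primSum = tailSum` off the `s`-neighbourhood of the centres, uniform Taylor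
bound), coerced `ContDiffBump` cut-offs (`bumpC`) with `∂̄`-bounds and vanishing off the annulus, an
integrability/estimate lemma for `∫_Ω h g` with `h` vanishing on `ball a r`, and the synthesis
theorem `bumpSynthesis`: given `ψ ∈ C_c(Ω)` and `ε`, with `d = dist(a, tsupport ψ)`, `r = d/4`:
`Ψ = Σ c_w B(s⁻¹(z-w)) ≈_{ε₁} ψ` (stub B2, `s ≤ r`), its EXACT primitive `Θ_Ψ = Σ c_w s Θ(s⁻¹(z-w))`
equals the rational tail `Σ c_w m s²/(z-w)` on `closedBall a 2r`, whose Taylor polynomial `q_N` at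
`a` is `ε₂`-close there (ratio `1/2`); the two admissible test functions `χ₁ = Θ_Ψ (1-η_a) κ`,
`χ₂ = q_N (1-η_a) κ` (`η_a`, `κ`: `ContDiffBump` cut-offs at the root / at infinity) satisfy, on
`closedBall 0 R₀ ⊇ Ω ∪ {points}`, `∂̄χ₁ - ∂̄χ₂ = Ψ - (Θ_Ψ - q_N) ∂̄η_a`; five-term estimate
`|∫ψ dμ_δ - c∫ψg| ≤ ε₁|C_ψ| + ε₂ M_η |C_ann| + ε/6 + ‖c‖(ε₂ M_η G + ε₁ G) < ε`.

PART 2 (the line): the three SAW stubs, the two bump stubs, `bumpSynthesis_of_stubs` (PROVED from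
Part 1 — same signature as the live line's sorried `cauchySynthesis_of_stubs`), the composition.

Why it dodges the stuck goals of the live line: no singular kernel is ever integrated (`1/z` only
appears where it is holomorphic and explicit), so `stub_invLocallyIntegrable`, `stub_cauchyPompeiu`,
`stub_cauchyTransform`, `stub_holoOfDbar`, `stub_taylorUniform`, `stub_mollify` and the sorried glue
all disappear; what remains provable-but-open is two M-sized textbook lemmas.

Disproof used: every hypothesis of the F5 table of `Cruxes/HexObservableLimitR/Disproof.lean` is
carried by the three SAW stubs unchanged (both lattice pins, `0 < ρ`, the two marked limits, the
pole at the root, the continuous branch `L`); the constant produced is `6 c'` with `c'` from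
`stub_boundaryFlux` (real by F2 once proved); non-vacuity F6 untouched; no stub is an instance of a
landed `Negative/` lemma (the SAW stubs are the live line's audited ones, the bump stubs are pure
analysis).
-/

/-! ## PART 1 — generic explicit-bump synthesis (Mathlib only, sorry-free) -/

noncomputable section

open scoped BigOperators Topology
open Filter MeasureTheory Set Metric

set_option linter.deprecated false

namespace Summit.CriticalPhenomena.SAWScalingLimit.Cruxes.HexObservableLimitR.ExplicitBump

/-! ### `∂̄` in terms of the real Fréchet derivative -/

/-- `∂̄ f (z) = (Df(z)·1 + i · Df(z)·i)/2`. -/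
def dbar (f : ℂ → ℂ) (z : ℂ) : ℂ :=
  (fderiv ℝ f z 1 + Complex.I * fderiv ℝ f z Complex.I) / 2

theorem dbar_eq (f : ℂ → ℂ) (z : ℂ) :
    (fderiv ℝ f z 1 + Complex.I * fderiv ℝ f z Complex.I) / 2 = dbar f z := rfl

theorem dbar_fun_sub {f g : ℂ → ℂ} {z : ℂ} (hf : DifferentiableAt ℝ f z)
    (hg : DifferentiableAt ℝ g z) : dbar (fun w => f w - g w) z = dbar f z - dbar g z := by
  simp only [dbar, fderiv_fun_sub hf hg, ContinuousLinearMap.sub_apply]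
  ring

/-- Leibniz rule for `∂̄`. -/
theorem dbar_fun_mul {f g : ℂ → ℂ} {z : ℂ} (hf : DifferentiableAt ℝ f z)
    (hg : DifferentiableAt ℝ g z) :
    dbar (fun w => f w * g w) z = dbar f z * g z + f z * dbar g z := by
  simp only [dbar, fderiv_fun_mul hf hg, ContinuousLinearMap.add_apply,
    ContinuousLinearMap.smul_apply, smul_eq_mul]
  ring

theorem dbar_const_mul {f : ℂ → ℂ} {z : ℂ} (hf : DifferentiableAt ℝ f z) (b : ℂ) :
    dbar (fun w => b * f w) z = b * dbar f z := by
  simp only [dbar, fderiv_const_mul hf b, ContinuousLinearMap.smul_apply, smul_eq_mul]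
  ring

theorem dbar_fun_sum {ι : Type*} (s : Finset ι) {A : ι → ℂ → ℂ} {z : ℂ}
    (h : ∀ i ∈ s, DifferentiableAt ℝ (A i) z) :
    dbar (fun w => ∑ i ∈ s, A i w) z = ∑ i ∈ s, dbar (A i) z := by
  simp only [dbar, fderiv_fun_sum h, FunLike.coe_sum, Finset.sum_apply]
  rw [Finset.mul_sum, ← Finset.sum_add_distrib, Finset.sum_div]

/-- Functions agreeing near `z` have the same `∂̄` at `z`. -/
theorem dbar_congr {f g : ℂ → ℂ} {z : ℂ} (h : f =ᶠ[𝓝 z] g) : dbar f z = dbar g z := by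
  simp only [dbar, h.fderiv_eq]

/-- A complex-differentiable function has `∂̄ = 0`. -/
theorem dbar_eq_zero_of_differentiableAt {f : ℂ → ℂ} {z : ℂ} (hf : DifferentiableAt ℂ f z) :
    dbar f z = 0 := by
  have key : (fderiv ℝ f z) Complex.I = Complex.I * (fderiv ℝ f z) 1 := by
    rw [hf.fderiv_restrictScalars ℝ, ContinuousLinearMap.coe_restrictScalars', ← smul_eq_mul,
      ← ContinuousLinearMap.map_smul, smul_eq_mul, mul_one]
  simp only [dbar, key, ← mul_assoc, Complex.I_mul_I]
  ring

/-- A locally constant function has `∂̄ = 0` there. -/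
theorem dbar_eq_zero_of_eventuallyEq_const {f : ℂ → ℂ} {z : ℂ} (b : ℂ) (h : f =ᶠ[𝓝 z] fun _ => b) :
    dbar f z = 0 := by
  rw [dbar_congr h]
  simp [dbar]

/-- Chain rule for `∂̄` under a real dilation-translation `z ↦ t • (z - w)`. -/
theorem dbar_comp_smul_sub {f : ℂ → ℂ} (t : ℝ) (w z : ℂ)
    (hf : DifferentiableAt ℝ f (t • (z - w))) :
    dbar (fun y => f (t • (y - w))) z = t • dbar f (t • (z - w)) := by
  have hg : HasFDerivAt (fun y : ℂ => t • (y - w)) (t • ContinuousLinearMap.id ℝ ℂ) z :=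
    ((hasFDerivAt_id z).sub_const w).const_smul t
  have hcomp := hf.hasFDerivAt.comp z hg
  have e : fderiv ℝ (fun y => f (t • (y - w))) z = (fderiv ℝ f (t • (z - w))).comp
      (t • ContinuousLinearMap.id ℝ ℂ) := hcomp.fderiv
  simp only [dbar, e, ContinuousLinearMap.coe_comp, Function.comp_apply,
    ContinuousLinearMap.smul_apply, ContinuousLinearMap.id_apply, ContinuousLinearMap.map_smul]
  simp only [Complex.real_smul]
  ring

/-- The dilation-translation written with a complex division is the real scalar action. -/
theorem div_ofReal_eq_smul (s : ℝ) (z w : ℂ) : (z - w) / (s : ℂ) = (s⁻¹ : ℝ) • (z - w) := by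
  rw [Complex.real_smul, Complex.ofReal_inv, div_eq_inv_mul]

/-! ### Geometric-series Taylor polynomial of `1/(z - w)` at `a` -/

/-- The degree-`< N` Taylor polynomial of `z ↦ 1/(z-w)` at `a`. -/
def geomTaylor (a w : ℂ) (N : ℕ) (z : ℂ) : ℂ :=
  -∑ n ∈ Finset.range N, (z - a) ^ n / (w - a) ^ (n + 1)

theorem differentiable_geomTaylor (a w : ℂ) (N : ℕ) : Differentiable ℂ (geomTaylor a w N) := by
  unfold geomTaylor
  fun_prop

theorem contDiff_geomTaylor (a w : ℂ) (N : ℕ) {n : WithTop ℕ∞} :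
    ContDiff ℝ n (geomTaylor a w N) := by
  have : ContDiff ℂ n (geomTaylor a w N) := by
    unfold geomTaylor
    fun_prop
  exact this.restrict_scalars ℝ

/-- Remainder of the geometric series: on `closedBall a ρ` with `ρ < ‖w - a‖`,
`‖1/(z-w) - geomTaylor a w N z‖ ≤ (ρ/‖w-a‖)^N / (‖w-a‖ - ρ)`. -/
theorem geomTaylor_remainder {a w z : ℂ} {ρ : ℝ} (hρ : 0 ≤ ρ) (hz : ‖z - a‖ ≤ ρ)
    (hw : ρ < ‖w - a‖) (N : ℕ) :
    ‖(z - w)⁻¹ - geomTaylor a w N z‖ ≤ (ρ / ‖w - a‖) ^ N / (‖w - a‖ - ρ) := by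
  have hwa : 0 < ‖w - a‖ := hρ.trans_lt hw
  have hwa' : w - a ≠ 0 := norm_pos_iff.1 hwa
  set u : ℂ := (z - a) / (w - a) with hu
  have hu_norm : ‖u‖ ≤ ρ / ‖w - a‖ := by
    rw [hu, norm_div]; exact div_le_div_of_nonneg_right hz hwa.le
  have hu_lt : ‖u‖ < 1 := hu_norm.trans_lt ((div_lt_one hwa).2 hw)
  have hu1 : u ≠ 1 := by
    intro h1; rw [h1] at hu_lt; simp at hu_lt
  have hzw : z - w = (w - a) * (u - 1) := by rw [hu]; field_simp; ring
  have hzw0 : z - w ≠ 0 := by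
    rw [hzw]; exact mul_ne_zero hwa' (sub_ne_zero.2 hu1)
  -- the polynomial is `(1/(z-w)) (1 - u^N)`
  have hpoly : geomTaylor a w N z = (z - w)⁻¹ * (1 - u ^ N) := by
    have hsum : ∑ n ∈ Finset.range N, (z - a) ^ n / (w - a) ^ (n + 1) =
        (w - a)⁻¹ * ∑ n ∈ Finset.range N, u ^ n := by
      rw [Finset.mul_sum]
      refine Finset.sum_congr rfl fun n _ => ?_
      rw [hu, div_pow, pow_succ]; field_simp
    rw [geomTaylor, hsum, geom_sum_eq hu1, hzw]
    field_simp [sub_ne_zero.2 hu1, sub_ne_zero.2 (Ne.symm hu1)]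
    ring
  have hrem : (z - w)⁻¹ - geomTaylor a w N z = (z - w)⁻¹ * u ^ N := by rw [hpoly]; ring
  rw [hrem, norm_mul, norm_inv, norm_pow]
  have hzw_ge : ‖w - a‖ - ρ ≤ ‖z - w‖ := by
    have := norm_sub_norm_le (w - a) (z - a)
    have e : w - a - (z - a) = -(z - w) := by ring
    rw [e, norm_neg] at this
    linarith
  have hden : 0 < ‖w - a‖ - ρ := sub_pos.2 hw
  calc ‖z - w‖⁻¹ * ‖u‖ ^ N ≤ (‖w - a‖ - ρ)⁻¹ * (ρ / ‖w - a‖) ^ N :=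
        mul_le_mul (inv_anti₀ hden hzw_ge) (pow_le_pow_left₀ (norm_nonneg _) hu_norm N)
          (by positivity) (by positivity)
    _ = (ρ / ‖w - a‖) ^ N / (‖w - a‖ - ρ) := (div_eq_inv_mul _ _).symm


/-- Monotonicity of the geometric remainder bound in the distance of the pole. -/
theorem geomBound_mono {ρ d D : ℝ} (hρ : 0 ≤ ρ) (hρd : ρ < d) (hdD : d ≤ D) (N : ℕ) :
    (ρ / D) ^ N / (D - ρ) ≤ (ρ / d) ^ N / (d - ρ) := by
  have hd : 0 < d := hρ.trans_lt hρd
  have hD : 0 < D := hd.trans_le hdD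
  gcongr

/-! ### The dilated-translated family built from the bump -/

section Family

variable {B Θ : ℂ → ℂ} {m : ℂ} {s : ℝ} {ι : Finset ℂ} {c : ℂ → ℂ}

/-- The bump approximant `Ψ = Σ_w c_w B(s⁻¹ (z - w))`. -/
def bumpSum (B : ℂ → ℂ) (s : ℝ) (ι : Finset ℂ) (c : ℂ → ℂ) (z : ℂ) : ℂ :=
  ∑ w ∈ ι, c w * B ((s⁻¹ : ℝ) • (z - w))

/-- Its explicit `∂̄`-primitive `Θ_Ψ = Σ_w c_w s Θ(s⁻¹ (z - w))`. -/
def primSum (Θ : ℂ → ℂ) (s : ℝ) (ι : Finset ℂ) (c : ℂ → ℂ) (z : ℂ) : ℂ :=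
  ∑ w ∈ ι, c w * ((s : ℂ) * Θ ((s⁻¹ : ℝ) • (z - w)))

/-- The rational tail `Σ_w c_w m s² /(z - w)` of the primitive. -/
def tailSum (m : ℂ) (s : ℝ) (ι : Finset ℂ) (c : ℂ → ℂ) (z : ℂ) : ℂ :=
  ∑ w ∈ ι, c w * (m * (s : ℂ) ^ 2) * (z - w)⁻¹

/-- The Taylor polynomial at `a` of the rational tail. -/
def taylorSum (m : ℂ) (s : ℝ) (ι : Finset ℂ) (c : ℂ → ℂ) (a : ℂ) (N : ℕ) (z : ℂ) : ℂ :=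
  ∑ w ∈ ι, c w * (m * (s : ℂ) ^ 2) * geomTaylor a w N z

theorem bumpSum_eq_div (B : ℂ → ℂ) (s : ℝ) (ι : Finset ℂ) (c : ℂ → ℂ) (z : ℂ) :
    ∑ w ∈ ι, c w * B ((z - w) / (s : ℂ)) = bumpSum B s ι c z := by
  simp only [bumpSum, div_ofReal_eq_smul]

theorem contDiff_comp_smul_sub {f : ℂ → ℂ} {n : WithTop ℕ∞} (hf : ContDiff ℝ n f) (t : ℝ) (w : ℂ) :
    ContDiff ℝ n fun z => f (t • (z - w)) :=
  hf.comp ((contDiff_id.sub contDiff_const).const_smul t)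

theorem continuous_bumpSum (hB : Continuous B) : Continuous (bumpSum B s ι c) := by
  unfold bumpSum
  fun_prop

theorem contDiff_primSum (hΘ : ContDiff ℝ 3 Θ) : ContDiff ℝ 3 (primSum Θ s ι c) := by
  unfold primSum
  exact ContDiff.sum fun w _ =>
    contDiff_const.mul (contDiff_const.mul (contDiff_comp_smul_sub hΘ _ _))

theorem differentiable_taylorSum (a : ℂ) (N : ℕ) :
    Differentiable ℂ (taylorSum m s ι c a N) := by
  have := fun w => differentiable_geomTaylor a w N
  unfold taylorSum
  fun_prop

theorem contDiff_taylorSum (a : ℂ) (N : ℕ) {n : WithTop ℕ∞} :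
    ContDiff ℝ n (taylorSum m s ι c a N) := by
  unfold taylorSum
  exact ContDiff.sum fun w _ => contDiff_const.mul (contDiff_geomTaylor a w N)

/-- `∂̄ Θ_Ψ = Ψ`. -/
theorem dbar_primSum (hs : 0 < s) (hΘ : ContDiff ℝ 3 Θ)
    (hΘB : ∀ z : ℂ, (fderiv ℝ Θ z 1 + Complex.I * fderiv ℝ Θ z Complex.I) / 2 = B z) (z : ℂ) :
    dbar (primSum Θ s ι c) z = bumpSum B s ι c z := by
  have hΘd : Differentiable ℝ Θ := hΘ.differentiable (by norm_num)
  have hcomp : ∀ w, Differentiable ℝ fun y : ℂ => Θ ((s⁻¹ : ℝ) • (y - w)) := fun w => by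
    fun_prop
  unfold primSum bumpSum
  rw [dbar_fun_sum]
  · refine Finset.sum_congr rfl fun w _ => ?_
    rw [dbar_const_mul (((hcomp w).const_mul _) z), dbar_const_mul ((hcomp w) z),
      dbar_comp_smul_sub _ _ _ (hΘd _)]
    rw [show dbar Θ ((s⁻¹ : ℝ) • (z - w)) = B ((s⁻¹ : ℝ) • (z - w)) from hΘB _]
    rw [Complex.real_smul, Complex.ofReal_inv, ← mul_assoc (s : ℂ),
      mul_inv_cancel₀ (Complex.ofReal_ne_zero.2 hs.ne'), one_mul]
  · intro w _
    exact (((hcomp w).const_mul _).const_mul _) z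

/-- Off the `s`-neighbourhood of the centres the primitive is the rational tail. -/
theorem primSum_eq_tailSum (hs : 0 < s) (hΘtail : ∀ z : ℂ, 1 ≤ ‖z‖ → Θ z = m * z⁻¹) {z : ℂ}
    (hz : ∀ w ∈ ι, s ≤ ‖z - w‖) : primSum Θ s ι c z = tailSum m s ι c z := by
  unfold primSum tailSum
  refine Finset.sum_congr rfl fun w hw => ?_
  have hn : 1 ≤ ‖(s⁻¹ : ℝ) • (z - w)‖ := by
    rw [norm_smul, Real.norm_eq_abs, abs_inv, abs_of_pos hs]
    rw [le_inv_mul_iff₀ hs, mul_one]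
    exact hz w hw
  rw [hΘtail _ hn, Complex.real_smul, Complex.ofReal_inv, mul_inv, inv_inv]
  ring

/-- The support of the bump approximant lies within `s` of its centres. -/
theorem exists_near_of_bumpSum_ne_zero (hs : 0 < s) (hBsupp : tsupport B ⊆ closedBall (0 : ℂ) 1)
    {z : ℂ} (hz : bumpSum B s ι c z ≠ 0) : ∃ w ∈ ι, ‖z - w‖ ≤ s := by
  obtain ⟨w, hw, hne⟩ := Finset.exists_ne_zero_of_sum_ne_zero hz
  refine ⟨w, hw, ?_⟩
  have hB : B ((s⁻¹ : ℝ) • (z - w)) ≠ 0 := fun h => hne (by rw [h, mul_zero])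
  have hmem : (s⁻¹ : ℝ) • (z - w) ∈ closedBall (0 : ℂ) 1 :=
    hBsupp (subset_tsupport _ (Function.mem_support.2 hB))
  rw [mem_closedBall, dist_zero_right, norm_smul, Real.norm_eq_abs, abs_inv, abs_of_pos hs,
    inv_mul_le_iff₀ hs, mul_one] at hmem
  exact hmem

/-- Uniform Taylor approximation of the tail on a disc around `a` avoiding the poles. -/
theorem norm_tailSum_sub_taylorSum_le {a z : ℂ} {ρ d : ℝ} (hρ : 0 ≤ ρ) (hρd : ρ < d)
    (hz : ‖z - a‖ ≤ ρ) (hd : ∀ w ∈ ι, d ≤ ‖w - a‖) (N : ℕ) :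
    ‖tailSum m s ι c z - taylorSum m s ι c a N z‖ ≤
      (∑ w ∈ ι, ‖c w‖) * (‖m‖ * s ^ 2) * ((ρ / d) ^ N / (d - ρ)) := by
  unfold tailSum taylorSum
  rw [← Finset.sum_sub_distrib, Finset.sum_mul, Finset.sum_mul]
  refine (norm_sum_le _ _).trans (Finset.sum_le_sum fun w hwι => ?_)
  rw [← mul_sub, norm_mul, norm_mul, norm_mul, norm_pow, Complex.norm_real, Real.norm_eq_abs,
    sq_abs]
  have hw : ρ < ‖w - a‖ := hρd.trans_le (hd w hwι)
  have h1 := geomTaylor_remainder hρ hz hw N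
  have h2 := geomBound_mono hρ hρd (hd w hwι) N
  have : ‖(z - w)⁻¹ - geomTaylor a w N z‖ ≤ (ρ / d) ^ N / (d - ρ) := h1.trans h2
  gcongr

end Family


/-! ### Cut-offs, integrability helpers -/

theorem continuous_dbar {f : ℂ → ℂ} (hf : ContDiff ℝ 3 f) : Continuous (dbar f) := by
  have hc : Continuous (fderiv ℝ f) := (hf.fderiv_right (m := 2) (by norm_num)).continuous
  unfold dbar
  exact ((hc.clm_apply continuous_const).add
    (continuous_const.mul (hc.clm_apply continuous_const))).div_const _

theorem differentiable_of_contDiff3 {f : ℂ → ℂ} (hf : ContDiff ℝ 3 f) : Differentiable ℝ f :=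
  hf.differentiable (by norm_num)

/-- The coerced bump `z ↦ (η z : ℂ)`. -/
def bumpC {a : ℂ} (η : ContDiffBump a) (z : ℂ) : ℂ := ((η z : ℝ) : ℂ)

theorem contDiff_bumpC {a : ℂ} (η : ContDiffBump a) {n : ℕ∞} : ContDiff ℝ n (bumpC η) :=
  Complex.ofRealCLM.contDiff.comp η.contDiff

theorem bumpC_eq_one_of_mem {a z : ℂ} (η : ContDiffBump a) (hz : z ∈ closedBall a η.rIn) :
    bumpC η z = 1 := by
  simp [bumpC, η.one_of_mem_closedBall hz]

theorem bumpC_eq_zero_of_le {a z : ℂ} (η : ContDiffBump a) (hz : η.rOut ≤ dist z a) :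
    bumpC η z = 0 := by
  simp [bumpC, η.zero_of_le_dist hz]

theorem bumpC_eventuallyEq_one {a z : ℂ} (η : ContDiffBump a) (hz : z ∈ ball a η.rIn) :
    bumpC η =ᶠ[𝓝 z] fun _ => (1 : ℂ) := by
  filter_upwards [η.eventuallyEq_one_of_mem_ball hz] with y hy
  simp [bumpC, hy]

theorem bumpC_eventuallyEq_zero {a z : ℂ} (η : ContDiffBump a) (hz : η.rOut < dist z a) :
    bumpC η =ᶠ[𝓝 z] fun _ => (0 : ℂ) := by
  have hz' : z ∉ tsupport η := by
    rw [η.tsupport_eq, mem_closedBall]; exact not_le.2 hz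
  filter_upwards [notMem_tsupport_iff_eventuallyEq.1 hz'] with y hy
  simp [bumpC, hy]

theorem dbar_bumpC_eq_zero_of_mem_ball {a z : ℂ} (η : ContDiffBump a) (hz : z ∈ ball a η.rIn) :
    dbar (bumpC η) z = 0 :=
  dbar_eq_zero_of_eventuallyEq_const 1 (bumpC_eventuallyEq_one η hz)

theorem dbar_bumpC_eq_zero_of_lt {a z : ℂ} (η : ContDiffBump a) (hz : η.rOut < dist z a) :
    dbar (bumpC η) z = 0 :=
  dbar_eq_zero_of_eventuallyEq_const 0 (bumpC_eventuallyEq_zero η hz)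

/-- A uniform bound for `∂̄` of a compactly supported `C³` function. -/
theorem exists_dbar_le {f : ℂ → ℂ} (h3 : ContDiff ℝ 3 f) (hcs : HasCompactSupport f) :
    ∃ M : ℝ, 0 ≤ M ∧ ∀ z, ‖dbar f z‖ ≤ M := by
  have hc : Continuous (fderiv ℝ f) := (h3.fderiv_right (m := 2) (by norm_num)).continuous
  obtain ⟨M₁, hM₁⟩ := (hc.clm_apply continuous_const).bounded_above_of_compact_support
    (hcs.fderiv_apply (𝕜 := ℝ) (1 : ℂ))
  obtain ⟨M₂, hM₂⟩ := (hc.clm_apply continuous_const).bounded_above_of_compact_support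
    (hcs.fderiv_apply (𝕜 := ℝ) Complex.I)
  refine ⟨(|M₁| + |M₂|) / 2, by positivity, fun z => ?_⟩
  unfold dbar
  rw [norm_div, Complex.norm_two]
  gcongr
  calc ‖fderiv ℝ f z 1 + Complex.I * fderiv ℝ f z Complex.I‖
      ≤ ‖fderiv ℝ f z 1‖ + ‖Complex.I * fderiv ℝ f z Complex.I‖ := norm_add_le _ _
    _ ≤ |M₁| + |M₂| := by
        rw [norm_mul, Complex.norm_I, one_mul]
        exact add_le_add ((hM₁ z).trans (le_abs_self _)) ((hM₂ z).trans (le_abs_self _))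

theorem hasCompactSupport_bumpC {a : ℂ} (η : ContDiffBump a) : HasCompactSupport (bumpC η) :=
  η.hasCompactSupport.comp_left (g := fun t : ℝ => (t : ℂ)) (by simp)

/-- A uniform bound for `∂̄` of a coerced bump. -/
theorem exists_dbar_bumpC_le {a : ℂ} (η : ContDiffBump a) :
    ∃ M : ℝ, 0 ≤ M ∧ ∀ z, ‖dbar (bumpC η) z‖ ≤ M :=
  exists_dbar_le (contDiff_bumpC η) (hasCompactSupport_bumpC η)

/-- `∂̄` of a coerced bump vanishes off the closed annulus `rIn ≤ |z - a| ≤ rOut`. -/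
theorem dbar_bumpC_eq_zero_of_not_mem {a z : ℂ} (η : ContDiffBump a)
    (hz : z ∉ closedBall a η.rOut \ ball a η.rIn) : dbar (bumpC η) z = 0 := by
  rw [mem_diff, not_and_or, not_not, mem_closedBall, not_le] at hz
  rcases hz with h | h
  · exact dbar_bumpC_eq_zero_of_lt η h
  · exact dbar_bumpC_eq_zero_of_mem_ball η h

section Integrals

variable {Ω : Set ℂ} {g h : ℂ → ℂ} {a : ℂ} {r : ℝ}

/-- Integrability and the basic bound for `∫_Ω h g` when `h` is continuous, bounded by `M` on `Ω`
and vanishes on `ball a r`, while `g` is integrable on `Ω ∖ ball a r`. -/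
theorem integrableOn_mul_and_norm_le (hΩ : IsOpen Ω) (hg : ContinuousOn g Ω)
    (hgi : IntegrableOn g (Ω \ ball a r)) (hh : Continuous h) {M : ℝ}
    (hM : ∀ z ∈ Ω, ‖h z‖ ≤ M) (h0 : ∀ z ∈ ball a r, h z = 0) :
    IntegrableOn (fun z => h z * g z) Ω ∧
      ‖∫ z in Ω, h z * g z‖ ≤ M * ∫ z in Ω \ ball a r, ‖g z‖ := by
  set G : ℂ → ℝ := (Ω \ ball a r).indicator fun z => ‖g z‖ with hG
  have hmeas : MeasurableSet (Ω \ ball a r) := hΩ.measurableSet.diff measurableSet_ball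
  have hgn : IntegrableOn (fun z => ‖g z‖) (Ω \ ball a r) := hgi.norm
  have hGi : Integrable G := hgn.integrable_indicator hmeas
  have hbound : ∀ z ∈ Ω, ‖h z * g z‖ ≤ M * G z := by
    intro z hz
    by_cases hb : z ∈ ball a r
    · rw [h0 z hb, zero_mul, norm_zero, hG, indicator_of_notMem (fun h => h.2 hb), mul_zero]
    · rw [hG, indicator_of_mem (show z ∈ Ω \ ball a r from ⟨hz, hb⟩), norm_mul]
      exact mul_le_mul_of_nonneg_right (hM z hz) (norm_nonneg _)
  have hae : ∀ᵐ z ∂(volume.restrict Ω), ‖h z * g z‖ ≤ M * G z :=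
    (ae_restrict_iff' hΩ.measurableSet).2 (Eventually.of_forall hbound)
  have hsm : AEStronglyMeasurable (fun z => h z * g z) (volume.restrict Ω) :=
    (hh.continuousOn.mul hg).aestronglyMeasurable hΩ.measurableSet
  have hMG : Integrable (fun z => M * G z) (volume.restrict Ω) := (hGi.const_mul M).restrict
  refine ⟨Integrable.mono' hMG hsm hae, ?_⟩
  calc ‖∫ z in Ω, h z * g z‖ ≤ ∫ z in Ω, M * G z := norm_integral_le_of_norm_le hMG hae
    _ = M * ∫ z in Ω \ ball a r, ‖g z‖ := by
        rw [integral_const_mul, hG, setIntegral_indicator hmeas,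
          inter_eq_right.2 diff_subset]

end Integrals



/-! ### The synthesis (Part 1 main theorem) -/

set_option maxHeartbeats 1600000 in
/-- **Explicit-bump synthesis.** From the two stubs `BumpPrimitive`, `BumpApproximation`:
finitely supported measures near a bounded open `Ω`, with mass eventually bounded on every
compact avoiding `a ∉ Ω`, whose `∂̄`-moments converge for every `χ ∈ C³_c(ℂ ∖ {a})` to
`c ∫_Ω ∂̄χ g`, converge against every `ψ ∈ C_c(Ω)` to `c ∫ ψ g`. -/
theorem bumpSynthesis
    (hPrim : ∃ (B Θ : ℂ → ℂ) (m : ℂ),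
      ContDiff ℝ 3 B ∧ HasCompactSupport B ∧ tsupport B ⊆ closedBall (0 : ℂ) 1 ∧
      (∫ z, B z) ≠ 0 ∧ ContDiff ℝ 3 Θ ∧
      (∀ z : ℂ, (fderiv ℝ Θ z 1 + Complex.I * fderiv ℝ Θ z Complex.I) / 2 = B z) ∧
      (∀ z : ℂ, 1 ≤ ‖z‖ → Θ z = m * z⁻¹))
    (hApprox : ∀ (B : ℂ → ℂ), Continuous B → HasCompactSupport B → (∫ z, B z) ≠ 0 →
      ∀ (ψ : ℂ → ℂ), Continuous ψ → HasCompactSupport ψ →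
      ∀ ε : ℝ, 0 < ε → ∀ s₀ : ℝ, 0 < s₀ →
        ∃ s : ℝ, 0 < s ∧ s ≤ s₀ ∧ ∃ (ι : Finset ℂ) (c : ℂ → ℂ), (↑ι : Set ℂ) ⊆ tsupport ψ ∧
          ∀ z : ℂ, ‖ψ z - ∑ w ∈ ι, c w * B ((z - w) / (s : ℂ))‖ ≤ ε)
    {α : Type*} (Ω : Set ℂ) (hΩ : IsOpen Ω)
    (hΩb : Bornology.IsBounded Ω) (a : ℂ) (ha : a ∉ Ω) (g : ℂ → ℂ) (hg : ContinuousOn g Ω)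
    (hgi : ∀ r : ℝ, 0 < r → IntegrableOn g (Ω \ ball a r)) (c : ℂ)
    (E : ℝ → Finset α) (pt : ℝ → α → ℂ) (w : ℝ → α → ℂ)
    (hnear : ∀ᶠ δ : ℝ in 𝓝[>] 0, ∀ p ∈ E δ, infDist (pt δ p) Ω ≤ δ)
    (hmass : ∀ K : Set ℂ, IsCompact K → a ∉ K → ∃ C : ℝ, ∀ᶠ δ : ℝ in 𝓝[>] 0,
      ∑ p ∈ E δ, K.indicator (fun _ => ‖w δ p‖) (pt δ p) ≤ C)
    (hdbar : ∀ χ : ℂ → ℂ, ContDiff ℝ 3 χ → HasCompactSupport χ → a ∉ tsupport χ →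
      Tendsto (fun δ : ℝ => ∑ p ∈ E δ,
        (fderiv ℝ χ (pt δ p) 1 + Complex.I * fderiv ℝ χ (pt δ p) Complex.I) / 2 * w δ p)
        (𝓝[>] 0)
        (𝓝 (c * ∫ z in Ω, (fderiv ℝ χ z 1 + Complex.I * fderiv ℝ χ z Complex.I) / 2 * g z)))
    (ψ : ℂ → ℂ) (hψ : Continuous ψ) (hψs : HasCompactSupport ψ) (hψΩ : tsupport ψ ⊆ Ω) :
    Tendsto (fun δ : ℝ => ∑ p ∈ E δ, ψ (pt δ p) * w δ p) (𝓝[>] 0) (𝓝 (c * ∫ z, ψ z * g z)) := by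
  -- ### Step 0: the trivial case `ψ = 0`
  set K : Set ℂ := tsupport ψ with hK
  rcases K.eq_empty_or_nonempty with hK0 | hKne
  · have hψ0 : ψ = 0 := tsupport_eq_empty_iff.1 hK0
    simp only [hψ0, Pi.zero_apply, zero_mul, Finset.sum_const_zero, integral_zero, mul_zero]
    exact tendsto_const_nhds
  -- ### Step 1: geometry — `d = dist(a, K)`, `r = d/4`, the two root-free compacts
  have hKc : IsCompact K := hψs
  have haK : a ∉ K := fun h => ha (hψΩ h)
  have hd : 0 < infDist a K := (hKc.isClosed.notMem_iff_infDist_pos hKne).1 haK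
  set d : ℝ := infDist a K with hd_def
  set r : ℝ := d / 4 with hr_def
  have hr : 0 < r := by positivity
  have hdr : d = 4 * r := by rw [hr_def]; ring
  have hdist : ∀ x ∈ K, d ≤ ‖x - a‖ := fun x hx => by
    rw [← dist_eq_norm, dist_comm]; exact infDist_le_dist_of_mem hx
  -- `Kψ = cthickening r K` and the root annulus `Kann`
  set Kψ : Set ℂ := cthickening r K with hKψ
  have hKψc : IsCompact Kψ := hKc.cthickening
  have hKKψ : K ⊆ Kψ := self_subset_cthickening K
  have hKψ_mem : ∀ {z}, z ∈ Kψ → ∃ x ∈ K, dist z x ≤ r := fun {z} hz => by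
    rw [hKψ, hKc.cthickening_eq_biUnion_closedBall hr.le] at hz
    simpa only [mem_iUnion, mem_closedBall, exists_prop] using hz
  -- points of `Kψ` are at distance `≥ 3r` from `a`; in particular `a ∉ Kψ`
  have hKψ_far : ∀ {z}, z ∈ Kψ → 3 * r ≤ ‖z - a‖ := fun {z} hz => by
    obtain ⟨x, hx, hzx⟩ := hKψ_mem hz
    have h1 := hdist x hx
    have h2 : ‖x - a‖ ≤ ‖x - z‖ + ‖z - a‖ := norm_sub_le_norm_sub_add_norm_sub x z a
    have h3 : ‖x - z‖ ≤ r := by rw [← dist_eq_norm, dist_comm]; exact hzx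
    linarith
  have haKψ : a ∉ Kψ := fun h => by
    have := hKψ_far h
    rw [sub_self, norm_zero] at this
    linarith
  set Kann : Set ℂ := closedBall a (2 * r) \ ball a r with hKann
  have hKannc : IsCompact Kann := (isCompact_closedBall _ _).diff isOpen_ball
  have haKann : a ∉ Kann := fun h => h.2 (mem_ball_self hr)
  obtain ⟨Cψ, hCψ⟩ := hmass Kψ hKψc haKψ
  obtain ⟨Cann, hCann⟩ := hmass Kann hKannc haKann
  -- the integral of `|g|` away from the root
  set G : ℝ := ∫ z in Ω \ ball a r, ‖g z‖ with hG
  have hG0 : 0 ≤ G := integral_nonneg fun _ => norm_nonneg _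
  -- a big ball containing everything relevant
  obtain ⟨R, hR⟩ := hΩb.subset_closedBall 0
  set R₀ : ℝ := |R| + 2 + (‖a‖ + 2 * r) with hR₀
  have hR₀pos : 0 < R₀ := by positivity
  have hΩR₀ : ∀ z, infDist z Ω ≤ 1 → z ∈ closedBall (0 : ℂ) R₀ := by
    intro z hz
    have hΩne : Ω.Nonempty := hKne.mono hψΩ
    obtain ⟨y, hy, hzy⟩ := (infDist_lt_iff hΩne).1 (lt_of_le_of_lt hz one_lt_two)
    have hy' := hR hy
    rw [mem_closedBall, dist_zero_right] at hy' ⊢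
    have h1 : ‖z‖ ≤ dist z y + ‖y‖ := by
      rw [dist_eq_norm]; exact norm_le_norm_sub_add z y
    have : (0:ℝ) ≤ ‖a‖ + 2 * r := by positivity
    linarith [le_abs_self R]
  have hΩR₀' : Ω ⊆ closedBall 0 R₀ := fun z hz =>
    hΩR₀ z (by rw [infDist_zero_of_mem hz]; exact zero_le_one)
  have hballR₀ : closedBall a (2 * r) ⊆ closedBall 0 R₀ := fun z hz => by
    rw [mem_closedBall, dist_zero_right]
    rw [mem_closedBall, dist_eq_norm] at hz
    have h1 : ‖z‖ ≤ ‖z - a‖ + ‖a‖ := norm_le_norm_sub_add z a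
    have : (0:ℝ) ≤ |R| := abs_nonneg R
    linarith
  -- the root cut-off `η` and the cut-off at infinity `κ`
  let η : ContDiffBump a := ⟨r, 2 * r, hr, by linarith⟩
  let κ : ContDiffBump (0 : ℂ) := ⟨R₀ + 1, R₀ + 2, by positivity, by linarith⟩
  have hηrIn : η.rIn = r := rfl
  have hηrOut : η.rOut = 2 * r := rfl
  have hκrIn : κ.rIn = R₀ + 1 := rfl
  obtain ⟨Mη, hMη0, hMη⟩ := exists_dbar_bumpC_le η
  -- `κ ≡ 1` near every point of `closedBall 0 R₀`
  have hκ1 : ∀ z ∈ closedBall (0 : ℂ) R₀, bumpC κ =ᶠ[𝓝 z] fun _ => (1 : ℂ) := fun z hz =>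
    bumpC_eventuallyEq_one κ (by
      rw [mem_ball, dist_zero_right]
      rw [mem_closedBall, dist_zero_right] at hz
      rw [hκrIn]; linarith)
  -- ### Step 2: the bump, the tolerances, the approximant
  obtain ⟨B, Θ, m, hB3, hBcs, hBsupp, hBint, hΘ3, hΘB, hΘtail⟩ := hPrim
  have hBc : Continuous B := hB3.continuous
  obtain ⟨Mψ, hMψ⟩ := hψ.bounded_above_of_compact_support hψs
  -- ### the target, `ε`-wise
  refine Metric.tendsto_nhds.2 fun ε hε => ?_
  -- tolerances
  set A₁ : ℝ := |Cψ| + ‖c‖ * G + 1 with hA₁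
  set A₂ : ℝ := (Mη + 1) * (|Cann| + ‖c‖ * G + 1) with hA₂
  have hA₁0 : 0 < A₁ := by positivity
  have hA₂0 : 0 < A₂ := by positivity
  set ε₁ : ℝ := ε / (6 * A₁) with hε₁
  set ε₂ : ℝ := ε / (6 * A₂) with hε₂
  have hε₁0 : 0 < ε₁ := by positivity
  have hε₂0 : 0 < ε₂ := by positivity
  have hε₁A : ε₁ * A₁ = ε / 6 := by rw [hε₁]; field_simp
  have hε₂A : ε₂ * A₂ = ε / 6 := by rw [hε₂]; field_simp
  have htol₁ : ε₁ * |Cψ| ≤ ε / 6 := by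
    rw [← hε₁A]; exact mul_le_mul_of_nonneg_left (by rw [hA₁]; nlinarith [norm_nonneg c]) hε₁0.le
  have htol₂ : ε₁ * (‖c‖ * G) ≤ ε / 6 := by
    rw [← hε₁A]; exact mul_le_mul_of_nonneg_left (by rw [hA₁]; nlinarith [abs_nonneg Cψ]) hε₁0.le
  have htol₃ : ε₂ * Mη * |Cann| ≤ ε / 6 := by
    rw [← hε₂A, mul_assoc]
    refine mul_le_mul_of_nonneg_left ?_ hε₂0.le
    rw [hA₂]
    exact mul_le_mul (by linarith) (by nlinarith [norm_nonneg c]) (abs_nonneg _) (by linarith)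
  have htol₄ : ε₂ * Mη * (‖c‖ * G) ≤ ε / 6 := by
    rw [← hε₂A, mul_assoc]
    refine mul_le_mul_of_nonneg_left ?_ hε₂0.le
    rw [hA₂]
    exact mul_le_mul (by linarith) (by nlinarith [abs_nonneg Cann]) (by positivity) (by linarith)
  -- ### the approximant `Ψ` and its explicit primitive `Θf`
  obtain ⟨s, hs, hsr, ι, cf, hιK, hΨapprox⟩ := hApprox B hBc hBcs hBint ψ hψ hψs ε₁ hε₁0 r hr
  set Ψ : ℂ → ℂ := bumpSum B s ι cf with hΨdef
  have hΨ' : ∀ z, ‖ψ z - Ψ z‖ ≤ ε₁ := fun z => by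
    rw [hΨdef, ← bumpSum_eq_div]; exact hΨapprox z
  set Θf : ℂ → ℂ := primSum Θ s ι cf with hΘfdef
  have hΘf3 : ContDiff ℝ 3 Θf := contDiff_primSum hΘ3
  have hΘfd : Differentiable ℝ Θf := differentiable_of_contDiff3 hΘf3
  have hdΘf : ∀ z, dbar Θf z = Ψ z := dbar_primSum hs hΘ3 hΘB
  have hΨc : Continuous Ψ := continuous_bumpSum hBc
  have hιK' : ∀ x ∈ ι, x ∈ K := fun x hx => hιK (Finset.mem_coe.2 hx)
  have hιfar : ∀ x ∈ ι, d ≤ ‖x - a‖ := fun x hx => hdist x (hιK' x hx)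
  -- supports: `ψ`, `Ψ` live in `Kψ`, hence vanish within `3r` of the root
  have hΨKψ : ∀ z, Ψ z ≠ 0 → z ∈ Kψ := fun z hz => by
    obtain ⟨x, hx, hzx⟩ := exists_near_of_bumpSum_ne_zero hs hBsupp hz
    exact mem_cthickening_of_dist_le z x r K (hιK' x hx) (by rw [dist_eq_norm]; exact hzx.trans hsr)
  have hψKψ : ∀ z, ψ z ≠ 0 → z ∈ Kψ := fun z hz =>
    hKKψ (subset_tsupport _ (Function.mem_support.2 hz))
  have hΨball : ∀ z, ‖z - a‖ < 3 * r → Ψ z = 0 := fun z hz => by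
    by_contra h; exact (not_le.2 hz) (hKψ_far (hΨKψ z h))
  have hψball : ∀ z, ‖z - a‖ < 3 * r → ψ z = 0 := fun z hz => by
    by_contra h; exact (not_le.2 hz) (hKψ_far (hψKψ z h))
  -- ### the Taylor polynomial `q` of the rational tail on `closedBall a (2r)`
  set A : ℝ := (∑ x ∈ ι, ‖cf x‖) * (‖m‖ * s ^ 2) with hA
  have hA0 : 0 ≤ A := by positivity
  obtain ⟨N, hN⟩ := exists_pow_lt_of_lt_one (show 0 < ε₂ * (2 * r) / (A + 1) by positivity)
    (show (1 / 2 : ℝ) < 1 by norm_num)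
  set q : ℂ → ℂ := taylorSum m s ι cf a N with hqdef
  have hqd : Differentiable ℂ q := differentiable_taylorSum a N
  have hq3 : ContDiff ℝ 3 q := contDiff_taylorSum a N
  have hTaylor : ∀ z ∈ closedBall a (2 * r), ‖Θf z - q z‖ ≤ ε₂ := by
    intro z hz
    rw [mem_closedBall, dist_eq_norm] at hz
    have hfar : ∀ x ∈ ι, s ≤ ‖z - x‖ := fun x hx => by
      have h1 := hιfar x hx
      have h2 : ‖x - a‖ ≤ ‖x - z‖ + ‖z - a‖ := norm_sub_le_norm_sub_add_norm_sub x z a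
      rw [norm_sub_rev x z] at h2
      linarith
    rw [hΘfdef, primSum_eq_tailSum hs hΘtail hfar]
    have hb := norm_tailSum_sub_taylorSum_le (m := m) (s := s) (c := cf)
      (by positivity : (0:ℝ) ≤ 2 * r) (by linarith : 2 * r < d) hz hιfar N
    have h2rd : 2 * r / d = 1 / 2 := by rw [hdr]; field_simp; ring
    have hd2r : d - 2 * r = 2 * r := by rw [hdr]; ring
    rw [h2rd, hd2r] at hb
    refine hb.trans ?_
    have h2r : (0:ℝ) < 2 * r := by positivity
    have key : (A + 1) * ((1 / 2 : ℝ) ^ N / (2 * r)) ≤ ε₂ := by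
      have e : (A + 1) * ((1 / 2 : ℝ) ^ N / (2 * r)) = (1 / 2 : ℝ) ^ N * ((A + 1) / (2 * r)) := by
        ring
      rw [e]
      have := mul_lt_mul_of_pos_right hN (show 0 < (A + 1) / (2 * r) by positivity)
      refine this.le.trans (le_of_eq ?_)
      field_simp
    calc A * ((1 / 2 : ℝ) ^ N / (2 * r)) ≤ (A + 1) * ((1 / 2 : ℝ) ^ N / (2 * r)) := by
          gcongr; linarith
      _ ≤ ε₂ := key
  -- ### the two admissible test functions
  set P : ℂ → ℂ := fun z => Θf z - q z with hP
  set χ₁ : ℂ → ℂ := fun z => Θf z * (1 - bumpC η z) * bumpC κ z with hχ₁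
  set χ₂ : ℂ → ℂ := fun z => q z * (1 - bumpC η z) * bumpC κ z with hχ₂
  have hη3 : ContDiff ℝ 3 (bumpC η) := contDiff_bumpC η
  have hκ3 : ContDiff ℝ 3 (bumpC κ) := contDiff_bumpC κ
  have hone3 : ContDiff ℝ 3 (fun z => 1 - bumpC η z) := contDiff_const.sub hη3
  have hχ₁3 : ContDiff ℝ 3 χ₁ := (hΘf3.mul hone3).mul hκ3
  have hχ₂3 : ContDiff ℝ 3 χ₂ := (hq3.mul hone3).mul hκ3
  have hκcs : HasCompactSupport (bumpC κ) := hasCompactSupport_bumpC κ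
  have hχ₁cs : HasCompactSupport χ₁ := hκcs.mul_left
  have hχ₂cs : HasCompactSupport χ₂ := hκcs.mul_left
  have hvan : ∀ f : ℂ → ℂ, a ∉ tsupport (fun z => f z * (1 - bumpC η z) * bumpC κ z) := by
    intro f
    rw [notMem_tsupport_iff_eventuallyEq]
    filter_upwards [ball_mem_nhds a hr] with z hz
    rw [bumpC_eq_one_of_mem η (by rw [hηrIn]; exact ball_subset_closedBall hz)]
    simp
  have hχvan : ∀ (f : ℂ → ℂ) (z : ℂ), z ∈ ball a r →
      dbar (fun y => f y * (1 - bumpC η y) * bumpC κ y) z = 0 := by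
    intro f z hz
    apply dbar_eq_zero_of_eventuallyEq_const 0
    filter_upwards [isOpen_ball.mem_nhds hz] with y hy
    rw [bumpC_eq_one_of_mem η (by rw [hηrIn]; exact ball_subset_closedBall hy)]
    simp
  have T₁ := hdbar χ₁ hχ₁3 hχ₁cs (hvan Θf)
  have T₂ := hdbar χ₂ hχ₂3 hχ₂cs (hvan q)
  simp only [dbar_eq] at T₁ T₂
  -- ### the pointwise identity `∂̄(χ₁ - χ₂) = Ψ - P ∂̄η` on `closedBall 0 R₀`
  have hPd : Differentiable ℝ P := hΘfd.sub (hqd.restrictScalars ℝ)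
  have hηd : Differentiable ℝ (bumpC η) := differentiable_of_contDiff3 hη3
  have honed : Differentiable ℝ (fun z => 1 - bumpC η z) := differentiable_of_contDiff3 hone3
  have hiden : ∀ z ∈ closedBall (0:ℂ) R₀,
      dbar χ₁ z - dbar χ₂ z = Ψ z - P z * dbar (bumpC η) z := by
    intro z hz
    have hχd : ∀ y, χ₁ y - χ₂ y = P y * (1 - bumpC η y) * bumpC κ y := fun y => by
      simp only [hχ₁, hχ₂, hP]; ring
    have e1 : dbar χ₁ z - dbar χ₂ z = dbar (fun y => χ₁ y - χ₂ y) z :=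
      (dbar_fun_sub ((differentiable_of_contDiff3 hχ₁3) z)
        ((differentiable_of_contDiff3 hχ₂3) z)).symm
    have e2 : (fun y => χ₁ y - χ₂ y) =ᶠ[𝓝 z] fun y => P y * (1 - bumpC η y) := by
      filter_upwards [hκ1 z hz] with y hy
      rw [hχd y, hy, mul_one]
    rw [e1, dbar_congr e2, dbar_fun_mul (hPd z) (honed z)]
    have e3 : dbar P z = Ψ z := by
      rw [hP, dbar_fun_sub (hΘfd z) ((hqd.restrictScalars ℝ) z), hdΘf,
        dbar_eq_zero_of_differentiableAt (hqd z), sub_zero]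
    have e4 : dbar (fun y => 1 - bumpC η y) z = -dbar (bumpC η) z := by
      rw [dbar_fun_sub (differentiableAt_const _) (hηd z)]
      simp [dbar]
    rw [e3, e4]
    have e5 : Ψ z * (1 - bumpC η z) = Ψ z := by
      by_cases hzη : 2 * r ≤ dist z a
      · rw [bumpC_eq_zero_of_le η (by rw [hηrOut]; exact hzη)]; ring
      · rw [hΨball z (by rw [← dist_eq_norm]; push Not at hzη; linarith)]; ring
    rw [e5]; ring
  -- ### integrability and the integral-side estimates
  obtain ⟨M₁, -, hM₁⟩ := exists_dbar_le hχ₁3 hχ₁cs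
  obtain ⟨M₂, -, hM₂⟩ := exists_dbar_le hχ₂3 hχ₂cs
  have I₁ := integrableOn_mul_and_norm_le hΩ hg (hgi r hr) (continuous_dbar hχ₁3)
    (fun z _ => hM₁ z) (fun z hz => hχvan Θf z hz)
  have I₂ := integrableOn_mul_and_norm_le hΩ hg (hgi r hr) (continuous_dbar hχ₂3)
    (fun z _ => hM₂ z) (fun z hz => hχvan q z hz)
  have hball3 : ∀ z ∈ ball a r, ‖z - a‖ < 3 * r := fun z hz => by
    rw [mem_ball, dist_eq_norm] at hz; linarith
  have Iψ := integrableOn_mul_and_norm_le hΩ hg (hgi r hr) hψ (fun z _ => hMψ z)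
    (fun z hz => hψball z (hball3 z hz))
  -- the error integrand `h₄ = -(P ∂̄η)` and `h₅ = Ψ - ψ`
  set h₄ : ℂ → ℂ := fun z => -(P z * dbar (bumpC η) z) with hh₄
  set h₅ : ℂ → ℂ := fun z => Ψ z - ψ z with hh₅
  have hPc : Continuous P := hPd.continuous
  have hh₄c : Continuous h₄ := (hPc.mul (continuous_dbar hη3)).neg
  have hh₅c : Continuous h₅ := hΨc.sub hψ
  have hKann_eq : Kann = closedBall a η.rOut \ ball a η.rIn := by rw [hKann, hηrOut, hηrIn]
  have hPη : ∀ z, ‖P z * dbar (bumpC η) z‖ ≤ ε₂ * Mη * Kann.indicator (fun _ => (1:ℝ)) z := by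
    intro z
    by_cases hz : z ∈ Kann
    · rw [indicator_of_mem hz, mul_one, norm_mul]
      exact mul_le_mul (hTaylor z hz.1) (hMη z) (norm_nonneg _) hε₂0.le
    · rw [dbar_bumpC_eq_zero_of_not_mem η (by rwa [← hKann_eq]), mul_zero, norm_zero,
        indicator_of_notMem hz, mul_zero]
  have hh₄b : ∀ z ∈ Ω, ‖h₄ z‖ ≤ ε₂ * Mη := fun z _ => by
    simp only [hh₄, norm_neg]
    refine (hPη z).trans ?_
    by_cases hz : z ∈ Kann
    · rw [indicator_of_mem hz, mul_one]
    · rw [indicator_of_notMem hz, mul_zero]; positivity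
  have hh₄0 : ∀ z ∈ ball a r, h₄ z = 0 := fun z hz => by
    simp only [hh₄]
    rw [dbar_bumpC_eq_zero_of_mem_ball η (by rwa [hηrIn]), mul_zero, neg_zero]
  have hh₅b : ∀ z ∈ Ω, ‖h₅ z‖ ≤ ε₁ := fun z _ => by
    simp only [hh₅]; rw [norm_sub_rev]; exact hΨ' z
  have hh₅0 : ∀ z ∈ ball a r, h₅ z = 0 := fun z hz => by
    simp only [hh₅]
    rw [hΨball z (hball3 z hz), hψball z (hball3 z hz), sub_zero]
  have I₄ := integrableOn_mul_and_norm_le hΩ hg (hgi r hr) hh₄c hh₄b hh₄0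
  have I₅ := integrableOn_mul_and_norm_le hΩ hg (hgi r hr) hh₅c hh₅b hh₅0
  -- the integral identity
  have hInt : (c * ∫ z in Ω, dbar χ₁ z * g z) - (c * ∫ z in Ω, dbar χ₂ z * g z) -
      c * (∫ z in Ω, ψ z * g z) = c * (∫ z in Ω, h₄ z * g z) + c * (∫ z in Ω, h₅ z * g z) := by
    have e1 : ∫ z in Ω, h₄ z * g z = ∫ z in Ω, (dbar χ₁ z * g z - dbar χ₂ z * g z - Ψ z * g z) := by
      refine setIntegral_congr_fun hΩ.measurableSet fun z hz => ?_
      have := hiden z (hΩR₀' hz)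
      simp only [hh₄]
      rw [show dbar χ₁ z * g z - dbar χ₂ z * g z = (dbar χ₁ z - dbar χ₂ z) * g z by ring, this]
      ring
    have IΨ := integrableOn_mul_and_norm_le hΩ hg (hgi r hr) hΨc
      (fun z _ => (show ‖Ψ z‖ ≤ Mψ + ε₁ from by
        have h1 := hΨ' z
        have h2 := hMψ z
        have : ‖Ψ z‖ ≤ ‖ψ z‖ + ‖ψ z - Ψ z‖ := norm_le_insert (ψ z) (Ψ z)
        linarith))
      (fun z hz => hΨball z (hball3 z hz))
    have e2 : ∫ z in Ω, (dbar χ₁ z * g z - dbar χ₂ z * g z - Ψ z * g z) =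
        (∫ z in Ω, dbar χ₁ z * g z) - (∫ z in Ω, dbar χ₂ z * g z) - ∫ z in Ω, Ψ z * g z := by
      have h12 : Integrable (fun z => dbar χ₁ z * g z - dbar χ₂ z * g z) (volume.restrict Ω) :=
        I₁.1.sub I₂.1
      rw [integral_sub h12 IΨ.1, integral_sub I₁.1 I₂.1]
    have e3 : ∫ z in Ω, h₅ z * g z = (∫ z in Ω, Ψ z * g z) - ∫ z in Ω, ψ z * g z := by
      rw [← integral_sub IΨ.1 Iψ.1]
      refine setIntegral_congr_fun hΩ.measurableSet fun z _ => ?_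
      simp only [hh₅]; ring
    rw [e1, e2, e3]; ring
  -- ### the discrete side: eventually in `δ`
  have T : Tendsto (fun δ => ∑ p ∈ E δ, (dbar χ₁ (pt δ p) - dbar χ₂ (pt δ p)) * w δ p) (𝓝[>] 0)
      (𝓝 ((c * ∫ z in Ω, dbar χ₁ z * g z) - c * ∫ z in Ω, dbar χ₂ z * g z)) := by
    refine (T₁.sub T₂).congr' (Eventually.of_forall fun δ => ?_)
    rw [← Finset.sum_sub_distrib]
    exact Finset.sum_congr rfl fun p _ => by ring
  have hT := Metric.tendsto_nhds.1 T (ε / 6) (by positivity)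
  have hδ1 : ∀ᶠ δ : ℝ in 𝓝[>] 0, δ ∈ Ioc (0:ℝ) 1 := Ioc_mem_nhdsGT one_pos
  filter_upwards [hCψ, hCann, hnear, hT, hδ1] with δ hδψ hδann hδnear hδT hδ01
  -- all points lie in `closedBall 0 R₀`
  have hptR : ∀ p ∈ E δ, pt δ p ∈ closedBall (0:ℂ) R₀ := fun p hp =>
    hΩR₀ _ ((hδnear p hp).trans hδ01.2)
  -- rewrite the target integral over `Ω`
  have hψint : ∫ z, ψ z * g z = ∫ z in Ω, ψ z * g z := by
    refine (setIntegral_eq_integral_of_forall_compl_eq_zero fun z hz => ?_).symm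
    rw [image_eq_zero_of_notMem_tsupport (fun h => hz (hψΩ h)), zero_mul]
  rw [dist_eq_norm, hψint]
  -- the three pieces
  set Sψ : ℂ := ∑ p ∈ E δ, ψ (pt δ p) * w δ p with hSψ
  set SD : ℂ := ∑ p ∈ E δ, (dbar χ₁ (pt δ p) - dbar χ₂ (pt δ p)) * w δ p with hSD
  set LD : ℂ := (c * ∫ z in Ω, dbar χ₁ z * g z) - c * ∫ z in Ω, dbar χ₂ z * g z with hLD
  have hpiece1 : ‖Sψ - SD‖ ≤ ε₁ * |Cψ| + ε₂ * Mη * |Cann| := by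
    have e : Sψ - SD = ∑ p ∈ E δ, ((ψ (pt δ p) - Ψ (pt δ p)) * w δ p +
        (P (pt δ p) * dbar (bumpC η) (pt δ p)) * w δ p) := by
      rw [hSψ, hSD, ← Finset.sum_sub_distrib]
      refine Finset.sum_congr rfl fun p hp => ?_
      rw [hiden _ (hptR p hp)]; ring
    rw [e]
    refine (norm_sum_le _ _).trans ?_
    have hb : ∀ p ∈ E δ, ‖(ψ (pt δ p) - Ψ (pt δ p)) * w δ p +
        (P (pt δ p) * dbar (bumpC η) (pt δ p)) * w δ p‖ ≤
        ε₁ * Kψ.indicator (fun _ => ‖w δ p‖) (pt δ p) +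
          ε₂ * Mη * Kann.indicator (fun _ => ‖w δ p‖) (pt δ p) := by
      intro p hp
      refine (norm_add_le _ _).trans (add_le_add ?_ ?_)
      · rw [norm_mul]
        by_cases hz : pt δ p ∈ Kψ
        · rw [indicator_of_mem hz]
          exact mul_le_mul_of_nonneg_right (hΨ' _) (norm_nonneg _)
        · have h1 : ψ (pt δ p) = 0 := by by_contra h; exact hz (hψKψ _ h)
          have h2 : Ψ (pt δ p) = 0 := by by_contra h; exact hz (hΨKψ _ h)
          rw [h1, h2, sub_zero, norm_zero, zero_mul, indicator_of_notMem hz, mul_zero]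
      · rw [norm_mul]
        have := hPη (pt δ p)
        by_cases hz : pt δ p ∈ Kann
        · rw [indicator_of_mem hz] at this ⊢
          rw [mul_one] at this
          exact mul_le_mul_of_nonneg_right this (norm_nonneg _)
        · rw [indicator_of_notMem hz, mul_zero] at this
          rw [indicator_of_notMem hz, mul_zero]
          have h0 : ‖P (pt δ p) * dbar (bumpC η) (pt δ p)‖ = 0 := le_antisymm this (norm_nonneg _)
          rw [h0, zero_mul]
    refine (Finset.sum_le_sum hb).trans ?_
    rw [Finset.sum_add_distrib, ← Finset.mul_sum, ← Finset.mul_sum]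
    exact add_le_add (mul_le_mul_of_nonneg_left (hδψ.trans (le_abs_self _)) hε₁0.le)
      (mul_le_mul_of_nonneg_left (hδann.trans (le_abs_self _)) (mul_nonneg hε₂0.le hMη0))
  have hpiece2 : ‖SD - LD‖ < ε / 6 := by rw [← dist_eq_norm]; exact hδT
  have hpiece3 : ‖LD - c * ∫ z in Ω, ψ z * g z‖ ≤ ‖c‖ * (ε₂ * Mη * G) + ‖c‖ * (ε₁ * G) := by
    rw [hLD, hInt]
    refine (norm_add_le _ _).trans (add_le_add ?_ ?_)
    · rw [norm_mul]; exact mul_le_mul_of_nonneg_left I₄.2 (norm_nonneg _)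
    · rw [norm_mul]; exact mul_le_mul_of_nonneg_left I₅.2 (norm_nonneg _)
  calc ‖Sψ - c * ∫ z in Ω, ψ z * g z‖
      = ‖(Sψ - SD) + (SD - LD) + (LD - c * ∫ z in Ω, ψ z * g z)‖ := by congr 1; ring
    _ ≤ ‖Sψ - SD‖ + ‖SD - LD‖ + ‖LD - c * ∫ z in Ω, ψ z * g z‖ := norm_add₃_le
    _ < (ε₁ * |Cψ| + ε₂ * Mη * |Cann|) + ε / 6 + (‖c‖ * (ε₂ * Mη * G) + ‖c‖ * (ε₁ * G)) :=
        add_lt_add_of_lt_of_le (add_lt_add_of_le_of_lt hpiece1 hpiece2) hpiece3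
    _ ≤ ε / 6 + ε / 6 + ε / 6 + (ε / 6 + ε / 6) := by
        have e1 : ‖c‖ * (ε₂ * Mη * G) = ε₂ * Mη * (‖c‖ * G) := by ring
        have e2 : ‖c‖ * (ε₁ * G) = ε₁ * (‖c‖ * G) := by ring
        rw [e1, e2]
        linarith
    _ < ε := by linarith

end Summit.CriticalPhenomena.SAWScalingLimit.Cruxes.HexObservableLimitR.ExplicitBump

end


/-! ## PART 1b — stub B1 PROVED: an explicit bump with an explicit `∂̄`-primitive
(`Θ z = (1 - ρ(‖z‖²))/z`, `ρ t = smoothTransition (9/5 - 16t/5)`, `B = ∂̄Θ = -ρ'(‖z‖²)`, `∫ B > 0`). -/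

noncomputable section

open scoped BigOperators Topology ComplexConjugate
open Filter MeasureTheory Set Metric

namespace Summit.CriticalPhenomena.SAWScalingLimit.Cruxes.HexObservableLimitR.ExplicitBump


/-- `∂̄ f (z)`. -/
def dbar' (f : ℂ → ℂ) (z : ℂ) : ℂ :=
  (fderiv ℝ f z 1 + Complex.I * fderiv ℝ f z Complex.I) / 2

/-- The radial profile. -/
def rho (t : ℝ) : ℝ := Real.smoothTransition (9 / 5 - 16 / 5 * t)

theorem rho_contDiff {n : ℕ∞} : ContDiff ℝ n rho :=
  Real.smoothTransition.contDiff.comp (contDiff_const.sub (contDiff_const.mul contDiff_id))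

theorem rho_differentiable : Differentiable ℝ rho :=
  (rho_contDiff (n := 1)).differentiable (by norm_num)

theorem rho_antitone : Antitone rho := fun s t hst =>
  Real.smoothTransition.monotone (by linarith)

theorem rho_eq_one {t : ℝ} (ht : t ≤ 1 / 4) : rho t = 1 :=
  Real.smoothTransition.one_of_one_le (by linarith)

theorem rho_eq_zero {t : ℝ} (ht : 9 / 16 ≤ t) : rho t = 0 :=
  Real.smoothTransition.zero_of_nonpos (by linarith)

theorem deriv_rho_nonpos (t : ℝ) : deriv rho t ≤ 0 := rho_antitone.deriv_nonpos

theorem deriv_rho_eq_zero_of_lt {t : ℝ} (ht : t < 1 / 4) : deriv rho t = 0 := by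
  have h : rho =ᶠ[𝓝 t] fun _ => (1 : ℝ) := by
    filter_upwards [Iio_mem_nhds ht] with s hs
    exact rho_eq_one hs.le
  rw [h.deriv_eq]; simp

theorem deriv_rho_eq_zero_of_gt {t : ℝ} (ht : 9 / 16 < t) : deriv rho t = 0 := by
  have h : rho =ᶠ[𝓝 t] fun _ => (0 : ℝ) := by
    filter_upwards [Ioi_mem_nhds ht] with s hs
    exact rho_eq_zero hs.le
  rw [h.deriv_eq]; simp

theorem deriv_rho_contDiff {n : ℕ∞} : ContDiff ℝ n (deriv rho) := by
  have h := (rho_contDiff (n := n + 1))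
  exact (contDiff_succ_iff_deriv.1 h).2.2

/-- Some point where `ρ' < 0` (mean value theorem between `1/4` and `9/16`). -/
theorem exists_deriv_rho_neg : ∃ t ∈ Ioo (1 / 4 : ℝ) (9 / 16), deriv rho t < 0 := by
  obtain ⟨t, ht, h⟩ := exists_deriv_eq_slope rho (by norm_num : (1 / 4 : ℝ) < 9 / 16)
    rho_differentiable.continuous.continuousOn (rho_differentiable.differentiableOn)
  refine ⟨t, ht, ?_⟩
  rw [h, rho_eq_zero le_rfl, rho_eq_one le_rfl]
  norm_num

/-- The bump `φ z = ρ(‖z‖²)` (real-valued). -/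
def phiR (z : ℂ) : ℝ := rho (‖z‖ ^ 2)

/-- The primitive `Θ z = (1 - φ z)/z`. -/
def Theta (z : ℂ) : ℂ := (1 - (phiR z : ℂ)) * z⁻¹

/-- The bump `B z = -ρ'(‖z‖²)`, complex-valued. -/
def Bump (z : ℂ) : ℂ := ((-deriv rho (‖z‖ ^ 2) : ℝ) : ℂ)

theorem phiR_contDiff {n : ℕ∞} : ContDiff ℝ n phiR :=
  rho_contDiff.comp (contDiff_norm_sq ℝ)

theorem phiR_eq_one {z : ℂ} (hz : ‖z‖ ≤ 1 / 2) : phiR z = 1 :=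
  rho_eq_one (by nlinarith [norm_nonneg z])

theorem phiR_eq_zero {z : ℂ} (hz : 3 / 4 ≤ ‖z‖) : phiR z = 0 :=
  rho_eq_zero (by nlinarith [norm_nonneg z])

theorem Bump_contDiff {n : ℕ∞} : ContDiff ℝ n Bump := by
  unfold Bump
  exact Complex.ofRealCLM.contDiff.comp ((deriv_rho_contDiff.comp (contDiff_norm_sq ℝ)).neg)

theorem Bump_eq_zero_of_lt {z : ℂ} (hz : 3 / 4 < ‖z‖) : Bump z = 0 := by
  unfold Bump
  rw [deriv_rho_eq_zero_of_gt (by nlinarith [norm_nonneg z]), neg_zero, Complex.ofReal_zero]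

theorem Bump_eq_zero_of_small {z : ℂ} (hz : ‖z‖ < 1 / 2) : Bump z = 0 := by
  unfold Bump
  rw [deriv_rho_eq_zero_of_lt (by nlinarith [norm_nonneg z]), neg_zero, Complex.ofReal_zero]

theorem tsupport_Bump_subset : tsupport Bump ⊆ closedBall (0 : ℂ) 1 := by
  refine closure_minimal (fun z hz => ?_) isClosed_closedBall
  rw [mem_closedBall, dist_zero_right]
  by_contra h
  exact hz (Bump_eq_zero_of_lt (by linarith [not_le.1 h]))

theorem hasCompactSupport_Bump : HasCompactSupport Bump :=
  HasCompactSupport.of_support_subset_isCompact (isCompact_closedBall (0 : ℂ) 1)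
    ((subset_tsupport _).trans tsupport_Bump_subset)

/-- `Θ` vanishes near the origin. -/
theorem Theta_eventuallyEq_zero {z : ℂ} (hz : ‖z‖ < 1 / 2) : Theta =ᶠ[𝓝 z] fun _ => (0 : ℂ) := by
  have : ball (0 : ℂ) (1 / 2) ∈ 𝓝 z := isOpen_ball.mem_nhds (by rwa [mem_ball, dist_zero_right])
  filter_upwards [this] with w hw
  rw [mem_ball, dist_zero_right] at hw
  simp [Theta, phiR_eq_one hw.le]

/-- Off the closed disc of radius `3/4`, `Θ = 1/z` near the point. -/
theorem Theta_eventuallyEq_inv {z : ℂ} (hz : 3 / 4 < ‖z‖) : Theta =ᶠ[𝓝 z] fun w => w⁻¹ := by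
  have : {w : ℂ | 3 / 4 < ‖w‖} ∈ 𝓝 z := (isOpen_lt continuous_const continuous_norm).mem_nhds hz
  filter_upwards [this] with w hw
  simp [Theta, phiR_eq_zero (le_of_lt hw)]

theorem Theta_eq_inv {z : ℂ} (hz : 1 ≤ ‖z‖) : Theta z = 1 * z⁻¹ := by
  simp [Theta, phiR_eq_zero (by linarith : 3 / 4 ≤ ‖z‖)]

theorem Theta_contDiff {n : ℕ∞} : ContDiff ℝ n Theta := by
  refine contDiff_iff_contDiffAt.2 fun z => ?_
  by_cases hz : ‖z‖ < 1 / 2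
  · exact (contDiffAt_const (c := (0 : ℂ))).congr_of_eventuallyEq (Theta_eventuallyEq_zero hz)
  · have hz0 : z ≠ 0 := by
      intro h; apply hz; rw [h, norm_zero]; norm_num
    have h1 : ContDiffAt ℝ n (fun w : ℂ => (1 : ℂ) - (phiR w : ℂ)) z :=
      (contDiff_const.sub (Complex.ofRealCLM.contDiff.comp phiR_contDiff)).contDiffAt
    have h2 : ContDiffAt ℝ n (fun w : ℂ => w⁻¹) z := (contDiffAt_inv ℂ hz0).restrict_scalars ℝ
    exact h1.mul h2

/-- The real Fréchet derivative of `φ` (as a complex-valued function) in direction `v`. -/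
theorem fderiv_phiC_apply (z v : ℂ) :
    fderiv ℝ (fun w : ℂ => (phiR w : ℂ)) z v =
      ((deriv rho (‖z‖ ^ 2) * (2 * (conj z * v).re) : ℝ) : ℂ) := by
  have hn : HasFDerivAt (fun w : ℂ => ‖w‖ ^ 2) (2 • innerSL ℝ z) z :=
    (hasStrictFDerivAt_norm_sq z).hasFDerivAt
  have hr : HasDerivAt rho (deriv rho (‖z‖ ^ 2)) (‖z‖ ^ 2) :=
    (rho_differentiable _).hasDerivAt
  have hcomp : HasFDerivAt phiR (deriv rho (‖z‖ ^ 2) • (2 • innerSL ℝ z)) z :=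
    hr.comp_hasFDerivAt z hn
  have hC : HasFDerivAt (fun w : ℂ => (phiR w : ℂ))
      (Complex.ofRealCLM.comp (deriv rho (‖z‖ ^ 2) • (2 • innerSL ℝ z))) z :=
    Complex.ofRealCLM.hasFDerivAt.comp z hcomp
  rw [hC.fderiv]
  simp only [ContinuousLinearMap.coe_comp, Function.comp_apply, ContinuousLinearMap.smul_apply,
    innerSL_apply_apply, Complex.ofRealCLM_apply, smul_eq_mul]
  congr 1
  rw [Complex.inner z v]
  simp only [Complex.mul_re, Complex.conj_re, Complex.conj_im]
  ring

/-- `∂̄ φ = ρ'(‖z‖²) · z`. -/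
theorem dbar'_phiC (z : ℂ) :
    dbar' (fun w : ℂ => (phiR w : ℂ)) z = ((deriv rho (‖z‖ ^ 2) : ℝ) : ℂ) * z := by
  simp only [dbar', fderiv_phiC_apply]
  apply Complex.ext <;> simp [Complex.mul_re, Complex.mul_im] <;> ring

/-- `∂̄ Θ = B` everywhere. -/
theorem dbar'_Theta (z : ℂ) :
    (fderiv ℝ Theta z 1 + Complex.I * fderiv ℝ Theta z Complex.I) / 2 = Bump z := by
  by_cases hz : ‖z‖ < 1 / 2
  · rw [(Theta_eventuallyEq_zero hz).fderiv_eq, Bump_eq_zero_of_small hz]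
    simp
  · have hz0 : z ≠ 0 := by
      intro h; apply hz; rw [h, norm_zero]; norm_num
    have hφd : DifferentiableAt ℝ (fun w : ℂ => (phiR w : ℂ)) z :=
      ((Complex.ofRealCLM.contDiff.comp phiR_contDiff (n := 1)).differentiable (by norm_num)) z
    have h1d : DifferentiableAt ℝ (fun w : ℂ => (1 : ℂ) - (phiR w : ℂ)) z :=
      (differentiableAt_const _).sub hφd
    have hinvC : DifferentiableAt ℂ (fun w : ℂ => w⁻¹) z := differentiableAt_inv hz0
    have hinv : DifferentiableAt ℝ (fun w : ℂ => w⁻¹) z := hinvC.restrictScalars ℝ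
    have e : Theta = fun w => ((1 : ℂ) - (phiR w : ℂ)) * w⁻¹ := rfl
    rw [e, fderiv_fun_mul h1d hinv]
    simp only [ContinuousLinearMap.add_apply, ContinuousLinearMap.smul_apply, smul_eq_mul]
    rw [fderiv_fun_sub (differentiableAt_const _) hφd]
    simp only [fderiv_fun_const, Pi.zero_apply, zero_sub]
    -- `fderiv` of `w⁻¹` is complex-linear
    have key : (fderiv ℝ (fun w : ℂ => w⁻¹) z) Complex.I =
        Complex.I * (fderiv ℝ (fun w : ℂ => w⁻¹) z) 1 := by
      rw [hinvC.fderiv_restrictScalars ℝ, ContinuousLinearMap.coe_restrictScalars', ← smul_eq_mul,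
        ← ContinuousLinearMap.map_smul, smul_eq_mul, mul_one]
    have hφ1 := fderiv_phiC_apply z 1
    have hφI := fderiv_phiC_apply z Complex.I
    rw [key]
    simp only [ContinuousLinearMap.neg_apply]
    rw [hφ1, hφI]
    have hre : ((starRingEnd ℂ) z * 1).re = z.re := by simp
    have him : ((starRingEnd ℂ) z * Complex.I).re = z.im := by simp [Complex.mul_re]
    rw [hre, him]
    unfold Bump
    push_cast
    have hI : Complex.I * Complex.I = -1 := Complex.I_mul_I
    have hzz : z * z⁻¹ = 1 := mul_inv_cancel₀ hz0
    have hz' : (z.re : ℂ) + Complex.I * (z.im : ℂ) = z := by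
      apply Complex.ext <;> simp
    linear_combination ((1 - (phiR z : ℂ)) * (fderiv ℝ (fun w : ℂ => w⁻¹) z 1) / 2) * hI
      - (((deriv rho (‖z‖ ^ 2) : ℝ) : ℂ) * z⁻¹) * hz' - ((deriv rho (‖z‖ ^ 2) : ℝ) : ℂ) * hzz

/-- `∫ B ≠ 0`: `B` is the coercion of a continuous, compactly supported, non-negative real function
which is positive somewhere. -/
theorem integral_Bump_ne_zero : (∫ z, Bump z) ≠ 0 := by
  set b : ℂ → ℝ := fun z => -deriv rho (‖z‖ ^ 2) with hb
  have hB : Bump = fun z => ((b z : ℝ) : ℂ) := rfl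
  have hbc : Continuous b := (rho_contDiff (n := 1) |> fun _ =>
    (deriv_rho_contDiff (n := 0)).continuous.comp (continuous_norm.pow 2)).neg
  have hbcs : HasCompactSupport b := by
    refine HasCompactSupport.of_support_subset_isCompact (isCompact_closedBall (0 : ℂ) 1) ?_
    intro z hz
    rw [mem_closedBall, dist_zero_right]
    by_contra h
    apply hz
    simp only [hb, Function.mem_support, ne_eq] at *
    rw [deriv_rho_eq_zero_of_gt (by nlinarith [norm_nonneg z, not_le.1 h]), neg_zero]
  have hnn : 0 ≤ b := fun z => by
    simp only [hb, Pi.zero_apply, Left.nonneg_neg_iff]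
    exact deriv_rho_nonpos _
  obtain ⟨t, ht, hneg⟩ := exists_deriv_rho_neg
  have ht0 : 0 ≤ t := by linarith [ht.1]
  have hpt : b ((Real.sqrt t : ℝ) : ℂ) ≠ 0 := by
    simp only [hb, Complex.norm_real, Real.norm_eq_abs, abs_of_nonneg (Real.sqrt_nonneg t),
      Real.sq_sqrt ht0]
    linarith
  have hpos : 0 < ∫ z, b z :=
    integral_pos_of_integrable_nonneg_nonzero hbc (hbc.integrable_of_hasCompactSupport hbcs) hnn hpt
  simp only [hB]
  rw [integral_complex_ofReal]
  exact Complex.ofReal_ne_zero.2 hpos.ne'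

/-- **Stub B1 of line `explicit_bump_synthesis`, proved.** [folklore] -/
theorem bumpPrimitive :
    ∃ (B Θ : ℂ → ℂ) (m : ℂ),
      ContDiff ℝ 3 B ∧ HasCompactSupport B ∧ tsupport B ⊆ closedBall (0 : ℂ) 1 ∧
      (∫ z, B z) ≠ 0 ∧ ContDiff ℝ 3 Θ ∧
      (∀ z : ℂ, (fderiv ℝ Θ z 1 + Complex.I * fderiv ℝ Θ z Complex.I) / 2 = B z) ∧
      (∀ z : ℂ, 1 ≤ ‖z‖ → Θ z = m * z⁻¹) :=
  ⟨Bump, Theta, 1, Bump_contDiff, hasCompactSupport_Bump, tsupport_Bump_subset, integral_Bump_ne_zero,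
    Theta_contDiff, dbar'_Theta, fun _ hz => Theta_eq_inv hz⟩

end Summit.CriticalPhenomena.SAWScalingLimit.Cruxes.HexObservableLimitR.ExplicitBump

end


/-! ## PART 1c — stub B2 PROVED: approximation by dilated translates of a bump
(normalised mollification `(s² ∫B)⁻¹ ψ ∗ B(·/s)` + Riemann sums over the floor-grid cells). -/

noncomputable section

open scoped BigOperators Topology
open Filter MeasureTheory Set Metric

namespace Summit.CriticalPhenomena.SAWScalingLimit.Cruxes.HexObservableLimitR.ExplicitBump



/-! ### Scaling of the integral of a dilated translate -/

/-- `∫ f((z - w)/s) dw = s² ∫ f`. -/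
theorem integral_comp_div_sub {F : Type*} [NormedAddCommGroup F] [NormedSpace ℝ F]
    (f : ℂ → F) (z : ℂ) {s : ℝ} (hs : 0 < s) :
    ∫ w, f ((z - w) / (s : ℂ)) = s ^ 2 • ∫ u, f u := by
  have e : (fun w => f ((z - w) / (s : ℂ))) = fun w => (fun u => f ((s⁻¹ : ℝ) • u)) (z - w) := by
    funext w
    simp only [Complex.real_smul, Complex.ofReal_inv, div_eq_inv_mul]
  rw [e, integral_sub_left_eq_self (fun u => f ((s⁻¹ : ℝ) • u)) volume z]
  rw [Measure.integral_comp_inv_smul_of_nonneg volume f hs.le, Complex.finrank_real_complex]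

/-! ### The dilated translate `w ↦ B((z - w)/s)` -/

section Scaled

variable {B : ℂ → ℂ} {R s : ℝ}

theorem norm_le_of_bumpScaled_ne_zero (hs : 0 < s) (hR : tsupport B ⊆ closedBall (0 : ℂ) R)
    {z w : ℂ} (h : B ((z - w) / (s : ℂ)) ≠ 0) : ‖z - w‖ ≤ s * R := by
  have hmem : (z - w) / (s : ℂ) ∈ closedBall (0 : ℂ) R :=
    hR (subset_tsupport _ (Function.mem_support.2 h))
  rw [mem_closedBall, dist_zero_right, norm_div, Complex.norm_real, Real.norm_eq_abs,
    abs_of_pos hs, div_le_iff₀ hs] at hmem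
  linarith [mul_comm s R]

theorem continuous_bumpScaled (hB : Continuous B) (z : ℂ) (s : ℝ) :
    Continuous fun w : ℂ => B ((z - w) / (s : ℂ)) :=
  hB.comp ((continuous_const.sub continuous_id).div_const _)

theorem hasCompactSupport_bumpScaled (hs : 0 < s) (hR : tsupport B ⊆ closedBall (0 : ℂ) R)
    (z : ℂ) : HasCompactSupport fun w : ℂ => B ((z - w) / (s : ℂ)) := by
  refine HasCompactSupport.of_support_subset_isCompact (isCompact_closedBall z (s * R)) ?_
  intro w hw
  rw [mem_closedBall, dist_comm, dist_eq_norm]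
  exact norm_le_of_bumpScaled_ne_zero hs hR (Function.mem_support.1 hw)

theorem integrable_bumpScaled (hB : Continuous B) (hs : 0 < s)
    (hR : tsupport B ⊆ closedBall (0 : ℂ) R) (z : ℂ) :
    Integrable fun w : ℂ => B ((z - w) / (s : ℂ)) :=
  (continuous_bumpScaled hB z s).integrable_of_hasCompactSupport (hasCompactSupport_bumpScaled hs hR z)

end Scaled

/-! ### Mollification error -/

/-- If `ψ` oscillates by at most `ω` on `sR`-neighbourhoods (`tsupport B ⊆ closedBall 0 R`), then the
normalised mollification `(s² ∫B)⁻¹ ∫ ψ(w) B((z-w)/s) dw` is within `ω ‖B‖₁ / ‖∫B‖` of `ψ z`. -/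
theorem norm_mollify_sub_le {B : ℂ → ℂ} (hB : Continuous B)
    (hBi : (∫ z, B z) ≠ 0) {R : ℝ} (hR : tsupport B ⊆ closedBall (0 : ℂ) R)
    {ψ : ℂ → ℂ} (hψ : Continuous ψ) {s ω : ℝ} (hs : 0 < s)
    (z : ℂ) (hmod : ∀ w : ℂ, ‖z - w‖ ≤ s * R → ‖ψ w - ψ z‖ ≤ ω) :
    ‖((s : ℂ) ^ 2 * ∫ u, B u)⁻¹ * (∫ w, ψ w * B ((z - w) / (s : ℂ))) - ψ z‖ ≤
      ω * (∫ u, ‖B u‖) / ‖∫ u, B u‖ := by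
  set I : ℂ := ∫ u, B u with hI
  set Bz : ℂ → ℂ := fun w => B ((z - w) / (s : ℂ)) with hBz
  have hcBz : Continuous Bz := continuous_bumpScaled hB z s
  have hcsBz : HasCompactSupport Bz := hasCompactSupport_bumpScaled hs hR z
  have hiBz : Integrable Bz := integrable_bumpScaled hB hs hR z
  have hI0 : 0 < ‖I‖ := norm_pos_iff.2 hBi
  have hsI : (s : ℂ) ^ 2 * I ≠ 0 := mul_ne_zero (pow_ne_zero _ (Complex.ofReal_ne_zero.2 hs.ne')) hBi
  have hconst : ∫ w, ψ z * Bz w = (s : ℂ) ^ 2 * I * ψ z := by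
    rw [integral_const_mul, hBz, integral_comp_div_sub B z hs, ← hI, Complex.real_smul]
    push_cast; ring
  have hint₁ : Integrable (fun w => ψ w * Bz w) :=
    (hψ.mul hcBz).integrable_of_hasCompactSupport hcsBz.mul_left
  have hint₂ : Integrable (fun w => ψ z * Bz w) :=
    (continuous_const.mul hcBz).integrable_of_hasCompactSupport hcsBz.mul_left
  have key : ((s : ℂ) ^ 2 * I)⁻¹ * (∫ w, ψ w * Bz w) - ψ z =
      ((s : ℂ) ^ 2 * I)⁻¹ * ∫ w, (ψ w - ψ z) * Bz w := by
    have : ∫ w, (ψ w - ψ z) * Bz w = (∫ w, ψ w * Bz w) - ∫ w, ψ z * Bz w := by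
      rw [← integral_sub hint₁ hint₂]
      refine integral_congr_ae (Eventually.of_forall fun w => ?_)
      ring
    rw [this, hconst, mul_sub, ← mul_assoc, inv_mul_cancel₀ hsI, one_mul]
  have hbound : ‖∫ w, (ψ w - ψ z) * Bz w‖ ≤ ω * (s ^ 2 * ∫ u, ‖B u‖) := by
    have hle : ∀ w, ‖(ψ w - ψ z) * Bz w‖ ≤ ω * ‖Bz w‖ := by
      intro w
      rw [norm_mul]
      by_cases hBw : Bz w = 0
      · rw [hBw, norm_zero, mul_zero, mul_zero]
      · exact mul_le_mul_of_nonneg_right (hmod w (norm_le_of_bumpScaled_ne_zero hs hR hBw))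
          (norm_nonneg _)
    calc ‖∫ w, (ψ w - ψ z) * Bz w‖ ≤ ∫ w, ω * ‖Bz w‖ :=
          norm_integral_le_of_norm_le (hiBz.norm.const_mul ω) (Eventually.of_forall hle)
      _ = ω * (s ^ 2 * ∫ u, ‖B u‖) := by
          rw [integral_const_mul, hBz]
          congr 1
          have := integral_comp_div_sub (fun u => ‖B u‖) z hs
          simpa using this
  change ‖((s : ℂ) ^ 2 * I)⁻¹ * (∫ w, ψ w * Bz w) - ψ z‖ ≤ ω * (∫ u, ‖B u‖) / ‖I‖
  rw [key, norm_mul, norm_inv, norm_mul, norm_pow, Complex.norm_real, Real.norm_eq_abs,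
    abs_of_pos hs]
  have hs2 : 0 < s ^ 2 := by positivity
  calc (s ^ 2 * ‖I‖)⁻¹ * ‖∫ w, (ψ w - ψ z) * Bz w‖
      ≤ (s ^ 2 * ‖I‖)⁻¹ * (ω * (s ^ 2 * ∫ u, ‖B u‖)) := by gcongr
    _ = ω * (∫ u, ‖B u‖) / ‖I‖ := by field_simp


/-! ### Floor-grid cells -/

/-- Index of the floor-grid cell of mesh `h` containing `z`. -/
def cellIdx (h : ℝ) (z : ℂ) : ℤ × ℤ := (⌊z.re / h⌋, ⌊z.im / h⌋)

/-- The floor-grid cell with index `k`. -/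
def cell (h : ℝ) (k : ℤ × ℤ) : Set ℂ := cellIdx h ⁻¹' {k}

/-- The lower-left corner of the cell with index `k`. -/
def corner (h : ℝ) (k : ℤ × ℤ) : ℂ := ⟨k.1 * h, k.2 * h⟩

theorem measurable_cellIdx (h : ℝ) : Measurable (cellIdx h) := by
  unfold cellIdx
  exact ((Complex.measurable_re.div_const h).floor).prodMk ((Complex.measurable_im.div_const h).floor)

theorem measurableSet_cell (h : ℝ) (k : ℤ × ℤ) : MeasurableSet (cell h k) :=
  measurable_cellIdx h (measurableSet_singleton k)

theorem mem_cell_cellIdx (h : ℝ) (z : ℂ) : z ∈ cell h (cellIdx h z) := rfl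

theorem pairwiseDisjoint_cell (h : ℝ) (S : Set (ℤ × ℤ)) : S.PairwiseDisjoint (cell h) :=
  fun _ _ _ _ hne => Disjoint.preimage _ (disjoint_singleton.2 hne)

theorem cellIdx_corner {h : ℝ} (hh : 0 < h) (k : ℤ × ℤ) : cellIdx h (corner h k) = k := by
  unfold cellIdx corner
  simp only [mul_div_cancel_right₀ _ hh.ne', Int.floor_intCast]

theorem corner_mem_cell {h : ℝ} (hh : 0 < h) (k : ℤ × ℤ) : corner h k ∈ cell h k :=
  cellIdx_corner hh k

theorem corner_injective {h : ℝ} (hh : 0 < h) : Function.Injective (corner h) := fun k k' hk => by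
  have := congrArg (cellIdx h) hk
  rwa [cellIdx_corner hh, cellIdx_corner hh] at this

theorem abs_sub_lt_of_floor_eq {h : ℝ} (hh : 0 < h) {x : ℝ} {n : ℤ} (hn : ⌊x / h⌋ = n) :
    |x - n * h| < h := by
  rw [Int.floor_eq_iff] at hn
  rw [abs_sub_lt_iff]
  constructor
  · have := hn.2
    rw [div_lt_iff₀ hh] at this
    linarith
  · have := hn.1
    rw [le_div_iff₀ hh] at this
    linarith

theorem norm_sub_corner_lt {h : ℝ} (hh : 0 < h) {z : ℂ} {k : ℤ × ℤ} (hz : z ∈ cell h k) :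
    ‖z - corner h k‖ < 2 * h := by
  have hk : cellIdx h z = k := hz
  unfold cellIdx at hk
  have h1 : ⌊z.re / h⌋ = k.1 := congrArg Prod.fst hk
  have h2 : ⌊z.im / h⌋ = k.2 := congrArg Prod.snd hk
  have e1 := abs_sub_lt_of_floor_eq hh h1
  have e2 := abs_sub_lt_of_floor_eq hh h2
  calc ‖z - corner h k‖ ≤ |(z - corner h k).re| + |(z - corner h k).im| :=
        Complex.norm_le_abs_re_add_abs_im _
    _ < h + h := by
        apply add_lt_add
        · simpa [corner] using e1
        · simpa [corner] using e2
    _ = 2 * h := by ring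

theorem cell_subset_ball {h : ℝ} (hh : 0 < h) (k : ℤ × ℤ) : cell h k ⊆ ball (corner h k) (2 * h) :=
  fun _ hz => mem_ball.2 (by rw [dist_eq_norm]; exact norm_sub_corner_lt hh hz)

theorem volume_cell_lt_top {h : ℝ} (hh : 0 < h) (k : ℤ × ℤ) : volume (cell h k) < ⊤ :=
  (measure_mono (cell_subset_ball hh k)).trans_lt measure_ball_lt_top

/-- Norm of a corner is controlled by its index. -/
theorem norm_corner_le {h : ℝ} (hh : 0 < h) {M : ℕ} {k : ℤ × ℤ}
    (hk : k ∈ (Finset.Icc (-(M : ℤ)) M) ×ˢ (Finset.Icc (-(M : ℤ)) M)) : ‖corner h k‖ ≤ 2 * (M * h) := by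
  rw [Finset.mem_product, Finset.mem_Icc, Finset.mem_Icc] at hk
  obtain ⟨⟨h1, h2⟩, h3, h4⟩ := hk
  have hk1 : |(k.1 : ℝ)| ≤ M := by
    rw [abs_le]; exact ⟨by exact_mod_cast h1, by exact_mod_cast h2⟩
  have hk2 : |(k.2 : ℝ)| ≤ M := by
    rw [abs_le]; exact ⟨by exact_mod_cast h3, by exact_mod_cast h4⟩
  calc ‖corner h k‖ ≤ |(corner h k).re| + |(corner h k).im| := Complex.norm_le_abs_re_add_abs_im _
    _ = |(k.1 : ℝ)| * h + |(k.2 : ℝ)| * h := by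
        simp only [corner, abs_mul, abs_of_pos hh]
    _ ≤ M * h + M * h := by gcongr
    _ = 2 * (M * h) := by ring

/-- The index of a point of norm `≤ R` lies in the box of half-width `M ≥ R/h + 1`. -/
theorem cellIdx_mem_box {h : ℝ} (hh : 0 < h) {R : ℝ} {M : ℕ} (hM : R / h + 1 ≤ M) {z : ℂ}
    (hz : ‖z‖ ≤ R) : cellIdx h z ∈ (Finset.Icc (-(M : ℤ)) M) ×ˢ (Finset.Icc (-(M : ℤ)) M) := by
  have hre : |z.re| ≤ R := (Complex.abs_re_le_norm z).trans hz
  have him : |z.im| ≤ R := (Complex.abs_im_le_norm z).trans hz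
  have key : ∀ x : ℝ, |x| ≤ R → ⌊x / h⌋ ∈ Finset.Icc (-(M : ℤ)) M := by
    intro x hx
    rw [abs_le] at hx
    have hxh : x / h ≤ R / h := div_le_div_of_nonneg_right hx.2 hh.le
    have hxh' : -(R / h) ≤ x / h := by
      rw [neg_le, ← neg_div]; exact div_le_div_of_nonneg_right (by linarith) hh.le
    have hfl := Int.floor_le (x / h)
    have hfl' := Int.lt_floor_add_one (x / h)
    rw [Finset.mem_Icc]
    constructor
    · have h1 : (-(M : ℝ)) ≤ (⌊x / h⌋ : ℝ) := by linarith
      have h2 : ((-(M : ℤ) : ℤ) : ℝ) ≤ ((⌊x / h⌋ : ℤ) : ℝ) := by push_cast; exact h1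
      exact_mod_cast h2
    · have h1 : ((⌊x / h⌋ : ℤ) : ℝ) ≤ (M : ℝ) := by linarith
      have h2 : ((⌊x / h⌋ : ℤ) : ℝ) ≤ ((M : ℤ) : ℝ) := by push_cast; exact h1
      exact_mod_cast h2
  unfold cellIdx
  exact Finset.mem_product.2 ⟨key _ hre, key _ him⟩

/-! ### Riemann sums over the cells -/

/-- Riemann-sum error over the floor grid: if `F` is integrable, vanishes off the cells indexed by
`S`, and oscillates by at most `ω` at scale `2h`, then `∫ F` is within `ω Σ_S vol(cell)` of its
Riemann sum with corners as tags. -/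
theorem norm_integral_sub_riemannSum_le {F : ℂ → ℂ} (hFi : Integrable F) {h : ℝ} (hh : 0 < h)
    (S : Finset (ℤ × ℤ)) (hsupp : ∀ w, F w ≠ 0 → cellIdx h w ∈ S) {ω : ℝ}
    (hω : ∀ w w' : ℂ, ‖w - w'‖ < 2 * h → ‖F w - F w'‖ ≤ ω) :
    ‖(∫ w, F w) - ∑ k ∈ S, ((volume.real (cell h k) : ℝ) : ℂ) * F (corner h k)‖ ≤
      ω * ∑ k ∈ S, volume.real (cell h k) := by
  -- the integral splits over the cells
  have hU : ∫ w, F w = ∫ w in ⋃ k ∈ S, cell h k, F w := by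
    refine (setIntegral_eq_integral_of_forall_compl_eq_zero fun w hw => ?_).symm
    by_contra hF
    exact hw (mem_iUnion₂.2 ⟨cellIdx h w, hsupp w hF, mem_cell_cellIdx h w⟩)
  have hsplit : ∫ w in ⋃ k ∈ S, cell h k, F w = ∑ k ∈ S, ∫ w in cell h k, F w :=
    integral_biUnion_finset S (fun k _ => measurableSet_cell h k)
      ((pairwiseDisjoint_cell h (↑S : Set (ℤ × ℤ))))
      (fun k _ => hFi.integrableOn)
  have hconst : ∀ k ∈ S, ((volume.real (cell h k) : ℝ) : ℂ) * F (corner h k) =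
      ∫ _ in cell h k, F (corner h k) := fun k _ => by
    rw [setIntegral_const, Complex.real_smul]
  rw [hU, hsplit, Finset.sum_congr rfl hconst, ← Finset.sum_sub_distrib, Finset.mul_sum]
  refine (norm_sum_le _ _).trans (Finset.sum_le_sum fun k hk => ?_)
  have hint : IntegrableOn (fun _ => F (corner h k)) (cell h k) :=
    integrableOn_const (volume_cell_lt_top hh k).ne
  rw [← integral_sub hFi.integrableOn hint]
  refine norm_setIntegral_le_of_norm_le_const (volume_cell_lt_top hh k) fun w hw => ?_
  exact hω w (corner h k) (norm_sub_corner_lt hh hw)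

/-! ### The approximation theorem (stub B2) -/

/-- The index box of half-width `M`. -/
def box (M : ℕ) : Finset (ℤ × ℤ) := (Finset.Icc (-(M : ℤ)) M) ×ˢ (Finset.Icc (-(M : ℤ)) M)

/-- Sum of the volumes of the boxed cells: bounded by the volume of a big ball. -/
theorem sum_volumeReal_cell_le {h : ℝ} (hh : 0 < h) (hh1 : h ≤ 1) (M : ℕ) {R : ℝ}
    (hMR : (M : ℝ) * h ≤ R + 2) :
    ∑ k ∈ box M, volume.real (cell h k) ≤ volume.real (closedBall (0 : ℂ) (2 * R + 6)) := by
  rw [← measureReal_biUnion_finset (pairwiseDisjoint_cell h (↑(box M) : Set (ℤ × ℤ)))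
    (fun k _ => measurableSet_cell h k) (fun k _ => (volume_cell_lt_top hh k).ne)]
  refine measureReal_mono ?_ measure_closedBall_lt_top.ne
  intro z hz
  obtain ⟨k, hk, hzk⟩ := mem_iUnion₂.1 hz
  have h1 := norm_sub_corner_lt hh hzk
  have h2 := norm_corner_le hh (Finset.mem_coe.1 hk)
  rw [mem_closedBall, dist_zero_right]
  have h3 : ‖z‖ ≤ ‖z - corner h k‖ + ‖corner h k‖ := norm_le_norm_sub_add z (corner h k)
  have h4 : (M : ℝ) * h * 2 ≤ (R + 2) * 2 := by nlinarith
  nlinarith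

set_option maxHeartbeats 1600000 in
/-- **Stub B2 of line `explicit_bump_synthesis`, proved.** If `B ∈ C_c(ℂ)` has `∫ B ≠ 0`, then
every `ψ ∈ C_c(ℂ)` is, at arbitrarily small scales `s`, uniformly `ε`-close to a finite sum of
dilated translates `Σ_w c_w B((z - w)/s)` with centres in `tsupport ψ`. [folklore] -/
theorem bumpApproximation (B : ℂ → ℂ) (hB : Continuous B) (hBs : HasCompactSupport B)
    (hBi : (∫ z, B z) ≠ 0) (ψ : ℂ → ℂ) (hψ : Continuous ψ) (hψs : HasCompactSupport ψ)
    (ε : ℝ) (hε : 0 < ε) (s₀ : ℝ) (hs₀ : 0 < s₀) :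
    ∃ s : ℝ, 0 < s ∧ s ≤ s₀ ∧ ∃ (ι : Finset ℂ) (c : ℂ → ℂ), (↑ι : Set ℂ) ⊆ tsupport ψ ∧
      ∀ z : ℂ, ‖ψ z - ∑ w ∈ ι, c w * B ((z - w) / (s : ℂ))‖ ≤ ε := by
  -- ### radii of the supports
  obtain ⟨R₁, hR₁⟩ := (IsCompact.isBounded hBs).subset_closedBall (0 : ℂ)
  obtain ⟨R₂, hR₂⟩ := (IsCompact.isBounded hψs).subset_closedBall (0 : ℂ)
  set RB : ℝ := max R₁ 1 with hRB_def
  set Rψ : ℝ := max R₂ 1 with hRψ_def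
  have hRB1 : 1 ≤ RB := le_max_right _ _
  have hRψ1 : 1 ≤ Rψ := le_max_right _ _
  have hRB : tsupport B ⊆ closedBall (0 : ℂ) RB :=
    hR₁.trans (closedBall_subset_closedBall (le_max_left _ _))
  have hRψ : tsupport ψ ⊆ closedBall (0 : ℂ) Rψ :=
    hR₂.trans (closedBall_subset_closedBall (le_max_left _ _))
  -- ### constants
  set I : ℂ := ∫ u, B u with hI_def
  have hI : 0 < ‖I‖ := norm_pos_iff.2 hBi
  set L : ℝ := ∫ u, ‖B u‖ with hL_def
  have hL : 0 ≤ L := integral_nonneg fun _ => norm_nonneg _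
  obtain ⟨Mψ, hMψ⟩ := hψ.bounded_above_of_compact_support hψs
  obtain ⟨MB, hMB⟩ := hB.bounded_above_of_compact_support hBs
  set V₀ : ℝ := volume.real (closedBall (0 : ℂ) (2 * Rψ + 6)) with hV₀_def
  have hV₀ : 0 ≤ V₀ := measureReal_nonneg
  have hucψ : UniformContinuous ψ := hψs.uniformContinuous_of_continuous hψ
  have hucB : UniformContinuous B := hBs.uniformContinuous_of_continuous hB
  -- ### Step 1: the scale `s` (mollification error ≤ ε/2)
  set ω₁ : ℝ := ε * ‖I‖ / (2 * (L + 1)) with hω₁_def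
  have hω₁ : 0 < ω₁ := by positivity
  obtain ⟨η₁, hη₁, hη₁'⟩ := Metric.uniformContinuous_iff.1 hucψ ω₁ hω₁
  set s : ℝ := min s₀ (η₁ / (2 * RB)) with hs_def
  have hs : 0 < s := lt_min hs₀ (by positivity)
  have hss₀ : s ≤ s₀ := min_le_left _ _
  have hsRB : s * RB < η₁ := by
    have h1 : s ≤ η₁ / (2 * RB) := min_le_right _ _
    have h2 : s * RB ≤ η₁ / (2 * RB) * RB := mul_le_mul_of_nonneg_right h1 (by linarith)
    have h3 : η₁ / (2 * RB) * RB = η₁ / 2 := by field_simp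
    linarith
  have hmoll : ∀ z, ‖((s : ℂ) ^ 2 * I)⁻¹ * (∫ w, ψ w * B ((z - w) / (s : ℂ))) - ψ z‖ ≤ ε / 2 := by
    intro z
    have hmod : ∀ w : ℂ, ‖z - w‖ ≤ s * RB → ‖ψ w - ψ z‖ ≤ ω₁ := fun w hw => by
      have : dist w z < η₁ := by rw [dist_comm, dist_eq_norm]; linarith
      rw [← dist_eq_norm]; exact le_of_lt (hη₁' this)
    have key := norm_mollify_sub_le hB hBi hRB hψ hs z hmod
    refine key.trans ?_
    rw [← hI_def, ← hL_def]
    have e : ω₁ * L / ‖I‖ = ε / 2 * (L / (L + 1)) := by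
      rw [hω₁_def]; field_simp
    rw [e]
    have hfrac : L / (L + 1) ≤ 1 := by rw [div_le_one (by positivity)]; linarith
    calc ε / 2 * (L / (L + 1)) ≤ ε / 2 * 1 := by gcongr
      _ = ε / 2 := mul_one _
  refine ⟨s, hs, hss₀, ?_⟩
  -- ### Step 2: the mesh `h` (Riemann-sum error ≤ ε/2)
  set A : ℝ := |MB| + |Mψ| + 1 with hA_def
  have hA : 0 < A := by positivity
  set ω₂ : ℝ := ε * (s ^ 2 * ‖I‖) / (2 * (A * (V₀ + 1))) with hω₂_def
  have hω₂ : 0 < ω₂ := by positivity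
  obtain ⟨η₂, hη₂, hη₂'⟩ := Metric.uniformContinuous_iff.1 hucψ ω₂ hω₂
  obtain ⟨η₃, hη₃, hη₃'⟩ := Metric.uniformContinuous_iff.1 hucB ω₂ hω₂
  set h : ℝ := min 1 (min η₂ (s * η₃)) / 2 with hh_def
  have hmin : 0 < min 1 (min η₂ (s * η₃)) := lt_min one_pos (lt_min hη₂ (by positivity))
  have hh : 0 < h := by positivity
  have hh1 : h ≤ 1 := by
    have : min 1 (min η₂ (s * η₃)) ≤ 1 := min_le_left _ _
    rw [hh_def]; linarith
  have h2η₂ : 2 * h ≤ η₂ := by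
    have : min 1 (min η₂ (s * η₃)) ≤ η₂ := (min_le_right _ _).trans (min_le_left _ _)
    rw [hh_def]; linarith
  have h2η₃ : 2 * h ≤ s * η₃ := by
    have : min 1 (min η₂ (s * η₃)) ≤ s * η₃ := (min_le_right _ _).trans (min_le_right _ _)
    rw [hh_def]; linarith
  -- the index box
  set M : ℕ := ⌈Rψ / h⌉₊ + 1 with hM_def
  have hM : Rψ / h + 1 ≤ M := by
    rw [hM_def]; push_cast; linarith [Nat.le_ceil (Rψ / h)]
  have hMR : (M : ℝ) * h ≤ Rψ + 2 := by
    have hc : (⌈Rψ / h⌉₊ : ℝ) < Rψ / h + 1 := Nat.ceil_lt_add_one (by positivity)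
    rw [hM_def]; push_cast
    have : ((⌈Rψ / h⌉₊ : ℝ) + 1) * h ≤ (Rψ / h + 2) * h := by nlinarith
    have e : (Rψ / h + 2) * h = Rψ + 2 * h := by field_simp
    linarith
  set S : Finset (ℤ × ℤ) := box M with hS_def
  -- ### the data
  set vol : ℤ × ℤ → ℝ := fun k => volume.real (cell h k) with hvol
  set c : ℂ → ℂ := fun w => ((s : ℂ) ^ 2 * I)⁻¹ * ((vol (cellIdx h w) : ℝ) : ℂ) * ψ w with hc_def
  set ι : Finset ℂ := (S.filter fun k => ψ (corner h k) ≠ 0).image (corner h) with hι_def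
  refine ⟨ι, c, ?_, fun z => ?_⟩
  · -- centres lie in the support
    intro w hw
    rw [hι_def, Finset.coe_image] at hw
    obtain ⟨k, hk, rfl⟩ := hw
    have hk' := (Finset.mem_filter.1 (Finset.mem_coe.1 hk)).2
    exact subset_tsupport _ (Function.mem_support.2 hk')
  -- ### the estimate at `z`
  set F : ℂ → ℂ := fun w => ψ w * B ((z - w) / (s : ℂ)) with hF_def
  have hsI : ((s : ℂ) ^ 2 * I) ≠ 0 := mul_ne_zero (pow_ne_zero _ (Complex.ofReal_ne_zero.2 hs.ne'))
    hBi
  -- the finite sum is `(s² I)⁻¹ ×` the Riemann sum of `F`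
  have hsum : ∑ w ∈ ι, c w * B ((z - w) / (s : ℂ)) =
      ((s : ℂ) ^ 2 * I)⁻¹ * ∑ k ∈ S, ((vol k : ℝ) : ℂ) * F (corner h k) := by
    rw [hι_def, Finset.sum_image (fun k _ k' _ hkk => corner_injective hh hkk), Finset.sum_filter,
      Finset.mul_sum]
    refine Finset.sum_congr rfl fun k _ => ?_
    by_cases hψk : ψ (corner h k) ≠ 0
    · rw [if_pos hψk, hc_def, hF_def]
      simp only [cellIdx_corner hh]
      ring
    · rw [if_neg hψk, hF_def]
      simp only [not_not.1 hψk, zero_mul, mul_zero]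
  -- the Riemann-sum error
  have hFi : Integrable F :=
    (hψ.mul (continuous_bumpScaled hB z s)).integrable_of_hasCompactSupport hψs.mul_right
  have hsupp : ∀ w, F w ≠ 0 → cellIdx h w ∈ S := fun w hw => by
    have hψw : ψ w ≠ 0 := fun h0 => hw (by rw [hF_def]; simp [h0])
    have hwR : ‖w‖ ≤ Rψ := by
      have := hRψ (subset_tsupport _ (Function.mem_support.2 hψw))
      rwa [mem_closedBall, dist_zero_right] at this
    exact cellIdx_mem_box hh hM hwR
  have hωF : ∀ w w' : ℂ, ‖w - w'‖ < 2 * h → ‖F w - F w'‖ ≤ ω₂ * (|MB| + |Mψ|) := by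
    intro w w' hww
    have e : F w - F w' = (ψ w - ψ w') * B ((z - w) / (s : ℂ)) +
        ψ w' * (B ((z - w) / (s : ℂ)) - B ((z - w') / (s : ℂ))) := by rw [hF_def]; ring
    rw [e]
    have h1 : ‖ψ w - ψ w'‖ ≤ ω₂ := by
      rw [← dist_eq_norm]; exact le_of_lt (hη₂' (by rw [dist_eq_norm]; linarith))
    have h2 : ‖B ((z - w) / (s : ℂ)) - B ((z - w') / (s : ℂ))‖ ≤ ω₂ := by
      rw [← dist_eq_norm]
      refine le_of_lt (hη₃' ?_)
      rw [dist_eq_norm, ← sub_div, norm_div, Complex.norm_real, Real.norm_eq_abs, abs_of_pos hs,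
        div_lt_iff₀ hs]
      have : z - w - (z - w') = w' - w := by ring
      rw [this, norm_sub_rev]
      linarith
    calc ‖(ψ w - ψ w') * B ((z - w) / (s : ℂ)) + ψ w' * (B ((z - w) / (s : ℂ)) - B ((z - w') / (s : ℂ)))‖
        ≤ ‖ψ w - ψ w'‖ * ‖B ((z - w) / (s : ℂ))‖ + ‖ψ w'‖ * ‖B ((z - w) / (s : ℂ)) - B ((z - w') / (s : ℂ))‖ := by
          refine (norm_add_le _ _).trans ?_
          rw [norm_mul, norm_mul]
      _ ≤ ω₂ * |MB| + |Mψ| * ω₂ := by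
          gcongr
          · exact (hMB _).trans (le_abs_self _)
          · exact (hMψ _).trans (le_abs_self _)
      _ = ω₂ * (|MB| + |Mψ|) := by ring
  have hRS := norm_integral_sub_riemannSum_le hFi hh S hsupp hωF
  have hV : ∑ k ∈ S, vol k ≤ V₀ := sum_volumeReal_cell_le hh hh1 M hMR
  -- ### combine
  have hdecomp : ψ z - ∑ w ∈ ι, c w * B ((z - w) / (s : ℂ)) =
      -(((s : ℂ) ^ 2 * I)⁻¹ * (∫ w, F w) - ψ z) +
        ((s : ℂ) ^ 2 * I)⁻¹ * ((∫ w, F w) - ∑ k ∈ S, ((vol k : ℝ) : ℂ) * F (corner h k)) := by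
    rw [hsum]; ring
  rw [hdecomp]
  have hT1 : ‖-(((s : ℂ) ^ 2 * I)⁻¹ * (∫ w, F w) - ψ z)‖ ≤ ε / 2 := by
    rw [norm_neg]; exact hmoll z
  have hT2 : ‖((s : ℂ) ^ 2 * I)⁻¹ * ((∫ w, F w) - ∑ k ∈ S, ((vol k : ℝ) : ℂ) * F (corner h k))‖ ≤
      ε / 2 := by
    rw [norm_mul, norm_inv, norm_mul, norm_pow, Complex.norm_real, Real.norm_eq_abs, abs_of_pos hs]
    have hs2I : 0 < s ^ 2 * ‖I‖ := by positivity
    calc (s ^ 2 * ‖I‖)⁻¹ * ‖(∫ w, F w) - ∑ k ∈ S, ((vol k : ℝ) : ℂ) * F (corner h k)‖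
        ≤ (s ^ 2 * ‖I‖)⁻¹ * (ω₂ * (|MB| + |Mψ|) * V₀) := by
          gcongr
          refine hRS.trans ?_
          exact mul_le_mul_of_nonneg_left hV (by positivity)
      _ ≤ (s ^ 2 * ‖I‖)⁻¹ * (ε * (s ^ 2 * ‖I‖) / 2) := by
          gcongr
          have hfrac : (|MB| + |Mψ|) * V₀ / (A * (V₀ + 1)) ≤ 1 := by
            rw [div_le_one (by positivity), hA_def]
            have h1 : (|MB| + |Mψ|) * V₀ ≤ (|MB| + |Mψ|) * (V₀ + 1) :=
              mul_le_mul_of_nonneg_left (by linarith) (by positivity)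
            have h2 : (|MB| + |Mψ|) * (V₀ + 1) ≤ (|MB| + |Mψ| + 1) * (V₀ + 1) :=
              mul_le_mul_of_nonneg_right (by linarith) (by positivity)
            exact h1.trans h2
          have e : ω₂ * (|MB| + |Mψ|) * V₀ =
              ε * (s ^ 2 * ‖I‖) / 2 * ((|MB| + |Mψ|) * V₀ / (A * (V₀ + 1))) := by
            rw [hω₂_def]; field_simp
          rw [e]
          calc ε * (s ^ 2 * ‖I‖) / 2 * ((|MB| + |Mψ|) * V₀ / (A * (V₀ + 1)))
              ≤ ε * (s ^ 2 * ‖I‖) / 2 * 1 := by gcongr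
            _ = ε * (s ^ 2 * ‖I‖) / 2 := mul_one _
      _ = ε / 2 := by field_simp
  calc _ ≤ ‖-(((s : ℂ) ^ 2 * I)⁻¹ * (∫ w, F w) - ψ z)‖ +
        ‖((s : ℂ) ^ 2 * I)⁻¹ * ((∫ w, F w) - ∑ k ∈ S, ((vol k : ℝ) : ℂ) * F (corner h k))‖ :=
        norm_add_le _ _
    _ ≤ ε / 2 + ε / 2 := add_le_add hT1 hT2
    _ = ε := by ring

end Summit.CriticalPhenomena.SAWScalingLimit.Cruxes.HexObservableLimitR.ExplicitBump

end

/-! ## PART 2 — the line: SAW stubs (verbatim), the two bump stubs, the proved glue, the composition -/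

noncomputable section

namespace Summit.CriticalPhenomena.SAWScalingLimit.Cruxes.HexObservableLimitR.ExplicitBump

open Literature.Probability.RandomPlanarGeometry Literature.Probability.RandomPlanarGeometry.SAW
open Literature.Probability.LatticeModels Literature.Barriers.CriticalPhenomena
open Literature.Barriers.CriticalPhenomena.HexGreen
open Summit.CriticalPhenomena.SAWScalingLimit.Theorems.ConjugateClassNegligibleSynthesis
open Summit.CriticalPhenomena.SAWScalingLimit.Theorems.HexObservableLimitR
  (stub_reindex stub_greenLimit stub_densityIntegrable)
open scoped BigOperators Topology ComplexConjugate
open Filter MeasureTheory Set Metric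

/-! ### Stub 1 — the normalised mass bound (SAW input, open) -/

/-- **Mass bound (MB⁺).** In the setting of the crux, for every compact `K ⊆ ℂ` not containing the
root `a = D.pt 0` (it may meet `∂Ω` elsewhere), the `F_δ(b_δ)`-normalised `L¹`-mass of the critical
observable on the interior mid-edges with rescaled midpoint in `K` is eventually bounded:
`δ² Σ_{e ⊂ Λ_δ, δe ∈ K} |F_δ(e)| / |F_δ(b_δ)| ≤ C_K`. -/
theorem stub_massBound (D : DobrushinDomain) (ρ : ℝ) (Λ : ℝ → Finset HexVertex)
    (m : Fin 2 → ℝ → ℤ) (a b : ℝ → Sym2 HexVertex)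
    (Φ : ConformalEquiv D.carrier UpperHalfPlane.upperHalfPlaneSet) (L : ℂ → ℂ) (Lb : ℂ)
    (hρ : 0 < ρ)
    (hflat : ∀ i : Fin 2, D.carrier ∩ ball (D.pt i) ρ = {z : ℂ | (D.pt i).im < z.im} ∩ ball (D.pt i) ρ)
    (hdisc : ∀ᶠ δ : ℝ in 𝓝[>] 0, hexDomainSimplyConnected (Λ δ) ∧ a δ ∈ hexDomainBoundary (Λ δ) ∧
      b δ ∈ hexDomainBoundary (Λ δ) ∧ Nonempty (HexMidEdgeSAW (Λ δ) (a δ) (b δ)) ∧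
      (hexGraph.induce ((Λ δ : Finset HexVertex) : Set HexVertex)).Preconnected ∧
      (∀ v ∈ Λ δ, (δ : ℂ) * hexCenter v ∈ D.carrier) ∧
      (∀ i : Fin 2, ∀ v : HexVertex, (δ : ℂ) * hexCenter v ∈ ball (D.pt i) ρ → (v ∈ Λ δ ↔ m i δ ≤ v.1 1)))
    (hexh : ∀ K : Set ℂ, IsCompact K → K ⊆ D.carrier → ∀ᶠ δ : ℝ in 𝓝[>] 0,
      ∀ v : HexVertex, (δ : ℂ) * hexCenter v ∈ K → v ∈ Λ δ)
    (ha : Tendsto (fun δ : ℝ => (δ : ℂ) * hexMidpoint (a δ)) (𝓝[>] 0) (𝓝 (D.pt 0)))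
    (hb : Tendsto (fun δ : ℝ => (δ : ℂ) * hexMidpoint (b δ)) (𝓝[>] 0) (𝓝 (D.pt 1)))
    (hΦa : Tendsto (fun x => ‖Φ x‖) (𝓝[D.carrier] (D.pt 0)) atTop)
    (hΦb : Φ.HasBoundaryValue (D.pt 1) 0)
    (hL : ContinuousOn L D.carrier) (hexpL : ∀ z ∈ D.carrier, Complex.exp (L z) = deriv Φ z)
    (hLb : Tendsto L (𝓝[D.carrier] (D.pt 1)) (𝓝 Lb)) :
    ∀ K : Set ℂ, IsCompact K → D.pt 0 ∉ K → ∃ C : ℝ, ∀ᶠ δ : ℝ in 𝓝[>] 0,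
      ∑ v ∈ (Λ δ).filter (fun v => v.2 = 0), ∑ t ∈ (Λ δ).filter (fun t => hexGraph.Adj v t),
        K.indicator (fun _ =>
          ‖(δ : ℂ) ^ 2 * hexParafermionicObservable (Λ δ) (a δ) hexCriticalFugacity (5 / 8) s(v, t) /
              hexParafermionicObservable (Λ δ) (a δ) hexCriticalFugacity (5 / 8) (b δ)‖)
          ((δ : ℂ) * hexMidpoint s(v, t)) ≤ C := by
  sorry

/-! ### Stub 2 — boundary-inclusive twist null in Green form (SAW input, open) -/

/-- **Twist null (Green form, boundary-inclusive).** In the setting of the crux, for every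
`χ ∈ C³_c(ℂ ∖ {a})` the class-twisted pairing of `∂χ` with the normalised observable over the interior
mid-edges tends to `0`: `δ² Σ_{e={v,t} ⊂ Λ_δ} u_e ∂χ(δe) F_δ(e)/F_δ(b_δ) → 0`, `u_e = 12 (mid e - c_v)²`
the unit squared edge direction. (Plain `ψ`-averages see only the class average; this is the weak
curl-freeness of card weak-curl-exact-interior, up to the boundary away from `a`.) -/
theorem stub_twistNull (D : DobrushinDomain) (ρ : ℝ) (Λ : ℝ → Finset HexVertex)
    (m : Fin 2 → ℝ → ℤ) (a b : ℝ → Sym2 HexVertex)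
    (Φ : ConformalEquiv D.carrier UpperHalfPlane.upperHalfPlaneSet) (L : ℂ → ℂ) (Lb : ℂ)
    (hρ : 0 < ρ)
    (hflat : ∀ i : Fin 2, D.carrier ∩ ball (D.pt i) ρ = {z : ℂ | (D.pt i).im < z.im} ∩ ball (D.pt i) ρ)
    (hdisc : ∀ᶠ δ : ℝ in 𝓝[>] 0, hexDomainSimplyConnected (Λ δ) ∧ a δ ∈ hexDomainBoundary (Λ δ) ∧
      b δ ∈ hexDomainBoundary (Λ δ) ∧ Nonempty (HexMidEdgeSAW (Λ δ) (a δ) (b δ)) ∧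
      (hexGraph.induce ((Λ δ : Finset HexVertex) : Set HexVertex)).Preconnected ∧
      (∀ v ∈ Λ δ, (δ : ℂ) * hexCenter v ∈ D.carrier) ∧
      (∀ i : Fin 2, ∀ v : HexVertex, (δ : ℂ) * hexCenter v ∈ ball (D.pt i) ρ → (v ∈ Λ δ ↔ m i δ ≤ v.1 1)))
    (hexh : ∀ K : Set ℂ, IsCompact K → K ⊆ D.carrier → ∀ᶠ δ : ℝ in 𝓝[>] 0,
      ∀ v : HexVertex, (δ : ℂ) * hexCenter v ∈ K → v ∈ Λ δ)
    (ha : Tendsto (fun δ : ℝ => (δ : ℂ) * hexMidpoint (a δ)) (𝓝[>] 0) (𝓝 (D.pt 0)))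
    (hb : Tendsto (fun δ : ℝ => (δ : ℂ) * hexMidpoint (b δ)) (𝓝[>] 0) (𝓝 (D.pt 1)))
    (hΦa : Tendsto (fun x => ‖Φ x‖) (𝓝[D.carrier] (D.pt 0)) atTop)
    (hΦb : Φ.HasBoundaryValue (D.pt 1) 0)
    (hL : ContinuousOn L D.carrier) (hexpL : ∀ z ∈ D.carrier, Complex.exp (L z) = deriv Φ z)
    (hLb : Tendsto L (𝓝[D.carrier] (D.pt 1)) (𝓝 Lb)) :
    ∀ χ : ℂ → ℂ, ContDiff ℝ 3 χ → HasCompactSupport χ → D.pt 0 ∉ tsupport χ →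
      Tendsto (fun δ : ℝ =>
        ∑ v ∈ (Λ δ).filter (fun v => v.2 = 0), ∑ t ∈ (Λ δ).filter (fun t => hexGraph.Adj v t),
          (12 * (hexMidpoint s(v, t) - hexCenter v) ^ 2) *
            ((fderiv ℝ χ ((δ : ℂ) * hexMidpoint s(v, t)) 1 -
                Complex.I * fderiv ℝ χ ((δ : ℂ) * hexMidpoint s(v, t)) Complex.I) / 2) *
            ((δ : ℂ) ^ 2 * hexParafermionicObservable (Λ δ) (a δ) hexCriticalFugacity (5 / 8) s(v, t) /
              hexParafermionicObservable (Λ δ) (a δ) hexCriticalFugacity (5 / 8) (b δ)))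
        (𝓝[>] 0) (𝓝 0) := by
  sorry

/-! ### Stub 3 — the boundary flux limit in Green form (SAW input, open) -/

/-- **Boundary flux limit (Green form).** One universal `c' ≠ 0` such that, in the setting of the
crux, for every `χ ∈ C³_c(ℂ ∖ {a})` the normalised boundary flux
`δ Σ_{v ∈ Λ_δ, u ∼ v, u ∉ Λ_δ} χ(δ c_v) (mid{v,u} - c_v) F_δ({v,u}) / F_δ(b_δ)` (boundary mid-edges only:
`|F_δ|` = arc partition function, `arg F_δ` = rigid boundary winding phase) converges to
`c' ∫_Ω ∂̄χ · e^{(5/8)(L - L_b)} dA`. -/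
theorem stub_boundaryFlux : ∃ c' : ℂ, c' ≠ 0 ∧
    ∀ (D : DobrushinDomain) (ρ : ℝ) (Λ : ℝ → Finset HexVertex)
    (m : Fin 2 → ℝ → ℤ) (a b : ℝ → Sym2 HexVertex)
    (Φ : ConformalEquiv D.carrier UpperHalfPlane.upperHalfPlaneSet) (L : ℂ → ℂ) (Lb : ℂ),
    0 < ρ →
    (∀ i : Fin 2, D.carrier ∩ ball (D.pt i) ρ = {z : ℂ | (D.pt i).im < z.im} ∩ ball (D.pt i) ρ) →
    (∀ᶠ δ : ℝ in 𝓝[>] 0, hexDomainSimplyConnected (Λ δ) ∧ a δ ∈ hexDomainBoundary (Λ δ) ∧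
      b δ ∈ hexDomainBoundary (Λ δ) ∧ Nonempty (HexMidEdgeSAW (Λ δ) (a δ) (b δ)) ∧
      (hexGraph.induce ((Λ δ : Finset HexVertex) : Set HexVertex)).Preconnected ∧
      (∀ v ∈ Λ δ, (δ : ℂ) * hexCenter v ∈ D.carrier) ∧
      (∀ i : Fin 2, ∀ v : HexVertex, (δ : ℂ) * hexCenter v ∈ ball (D.pt i) ρ →
        (v ∈ Λ δ ↔ m i δ ≤ v.1 1))) →
    (∀ K : Set ℂ, IsCompact K → K ⊆ D.carrier → ∀ᶠ δ : ℝ in 𝓝[>] 0,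
      ∀ v : HexVertex, (δ : ℂ) * hexCenter v ∈ K → v ∈ Λ δ) →
    Tendsto (fun δ : ℝ => (δ : ℂ) * hexMidpoint (a δ)) (𝓝[>] 0) (𝓝 (D.pt 0)) →
    Tendsto (fun δ : ℝ => (δ : ℂ) * hexMidpoint (b δ)) (𝓝[>] 0) (𝓝 (D.pt 1)) →
    Tendsto (fun x => ‖Φ x‖) (𝓝[D.carrier] (D.pt 0)) atTop →
    Φ.HasBoundaryValue (D.pt 1) 0 →
    ContinuousOn L D.carrier → (∀ z ∈ D.carrier, Complex.exp (L z) = deriv Φ z) →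
    Tendsto L (𝓝[D.carrier] (D.pt 1)) (𝓝 Lb) →
    ∀ χ : ℂ → ℂ, ContDiff ℝ 3 χ → HasCompactSupport χ → D.pt 0 ∉ tsupport χ →
      Tendsto (fun δ : ℝ => (δ : ℂ) *
        ∑ v ∈ Λ δ, ∑ u ∈ (nbrs v).filter (· ∉ Λ δ),
          χ ((δ : ℂ) * hexCenter v) * ((hexMidpoint s(v, u) - hexCenter v) *
            hexParafermionicObservable (Λ δ) (a δ) hexCriticalFugacity (5 / 8) s(v, u)) /
            hexParafermionicObservable (Λ δ) (a δ) hexCriticalFugacity (5 / 8) (b δ))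
        (𝓝[>] 0)
        (𝓝 (c' * ∫ z in D.carrier,
          (fderiv ℝ χ z 1 + Complex.I * fderiv ℝ χ z Complex.I) / 2 *
            Complex.exp ((5 / 8 : ℂ) * (L z - Lb)))) := by
  sorry




/-! ### Analysis layer — the two EXPLICIT-BUMP stubs and the proved glue -/

/-- **Explicit bump with explicit `∂̄`-primitive (stub B1, PROVED in Part 1b).** There is ONE pair `(B, Θ)` of `C³`
functions on `ℂ` and a constant `m` with: `B` supported in the closed unit disc, `∫ B ≠ 0`,
`∂̄Θ = B` everywhere (`∂̄ = (∂_x + i ∂_y)/2`), and `Θ z = m / z` for `‖z‖ ≥ 1`.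
Construction: `Θ := (1 - φ) · z⁻¹` with `φ : ContDiffBump (0 : ℂ)`, `φ.rOut < 1` (so `Θ ≡ 0` near
`0` and `Θ = z⁻¹` off `ball 0 φ.rOut`), `B := ∂̄Θ = -(∂̄φ) · z⁻¹`, `m = 1`; `∫ B = π ≠ 0` by polar
coordinates (`integral_comp_polarCoord_symm`: `B` is `-φ_r'(|z|)/(2|z|) ≥ 0` for the radial,
radially non-increasing `φ`) or by Green's formula on a large rectangle
(`Complex.integral_boundary_rect_of_hasFDerivAt_real_off_countable`, `integral_inv_one_add_sq`).
[folklore] -/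
theorem stub_bumpPrimitive :
    ∃ (B Θ : ℂ → ℂ) (m : ℂ),
      ContDiff ℝ 3 B ∧ HasCompactSupport B ∧ tsupport B ⊆ closedBall (0 : ℂ) 1 ∧
      (∫ z, B z) ≠ 0 ∧ ContDiff ℝ 3 Θ ∧
      (∀ z : ℂ, (fderiv ℝ Θ z 1 + Complex.I * fderiv ℝ Θ z Complex.I) / 2 = B z) ∧
      (∀ z : ℂ, 1 ≤ ‖z‖ → Θ z = m * z⁻¹) :=
  bumpPrimitive   -- PROVED (Part 1b)

/-- **Approximation by dilated translates (stub B2, PROVED in Part 1c).** If `B ∈ C_c(ℂ)` has `∫ B ≠ 0`, then every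
`ψ ∈ C_c(ℂ)` is, for arbitrarily small scales `s`, uniformly `ε`-close to a finite sum
`Σ_{w ∈ ι} c_w B((z - w)/s)` with centres `w ∈ tsupport ψ`.
Proof: `ψ ∗ B_s → ψ` uniformly for the normalised mollifier `B_s = B(·/s)/(s² ∫B)` (uniform
continuity of `ψ`, `‖B‖₁ < ∞`), then the Riemann sums of `w ↦ ψ(w) B_s(z - w)` on the grid `hℤ²`
converge uniformly in `z` as `h → 0` (the integrand is uniformly equicontinuous in `w`); grid points
with `ψ(w) = 0` are dropped. [folklore] -/
theorem stub_bumpApproximation (B : ℂ → ℂ) (hB : Continuous B) (hBs : HasCompactSupport B)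
    (hBi : (∫ z, B z) ≠ 0) (ψ : ℂ → ℂ) (hψ : Continuous ψ) (hψs : HasCompactSupport ψ)
    (ε : ℝ) (hε : 0 < ε) (s₀ : ℝ) (hs₀ : 0 < s₀) :
    ∃ s : ℝ, 0 < s ∧ s ≤ s₀ ∧ ∃ (ι : Finset ℂ) (c : ℂ → ℂ), (↑ι : Set ℂ) ⊆ tsupport ψ ∧
      ∀ z : ℂ, ‖ψ z - ∑ w ∈ ι, c w * B ((z - w) / (s : ℂ))‖ ≤ ε :=
  bumpApproximation B hB hBs hBi ψ hψ hψs ε hε s₀ hs₀   -- PROVED (Part 1c)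

/-- **Explicit-bump synthesis (glue, PROVED from stubs B1–B2 via Part 1).** Let `Ω ⊆ ℂ` be open
and bounded, `a ∉ Ω`, `g` continuous on `Ω` and integrable on `Ω ∖ B(a, r)` for every `r > 0`. Let
`μ_δ = Σ_{p ∈ E_δ} w_δ(p) δ_{pt_δ(p)}` be finitely supported complex measures carried within distance
`δ` of `Ω`, with total variation eventually bounded on every compact `K ∌ a`, whose `∂̄`-moments
converge: `∫ ∂̄χ dμ_δ → c ∫_Ω ∂̄χ g` for every `χ ∈ C³_c(ℂ ∖ {a})`. Then `∫ ψ dμ_δ → c ∫ ψ g` for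
every `ψ ∈ C_c(Ω)`.  SAME statement as the live line's sorried `cauchySynthesis_of_stubs`. -/
theorem bumpSynthesis_of_stubs {α : Type*} (Ω : Set ℂ) (hΩ : IsOpen Ω)
    (hΩb : Bornology.IsBounded Ω) (a : ℂ) (ha : a ∉ Ω) (g : ℂ → ℂ) (hg : ContinuousOn g Ω)
    (hgi : ∀ r : ℝ, 0 < r → IntegrableOn g (Ω \ ball a r)) (c : ℂ)
    (E : ℝ → Finset α) (pt : ℝ → α → ℂ) (w : ℝ → α → ℂ)
    (hnear : ∀ᶠ δ : ℝ in 𝓝[>] 0, ∀ p ∈ E δ, infDist (pt δ p) Ω ≤ δ)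
    (hmass : ∀ K : Set ℂ, IsCompact K → a ∉ K → ∃ C : ℝ, ∀ᶠ δ : ℝ in 𝓝[>] 0,
      ∑ p ∈ E δ, K.indicator (fun _ => ‖w δ p‖) (pt δ p) ≤ C)
    (hdbar : ∀ χ : ℂ → ℂ, ContDiff ℝ 3 χ → HasCompactSupport χ → a ∉ tsupport χ →
      Tendsto (fun δ : ℝ => ∑ p ∈ E δ,
        (fderiv ℝ χ (pt δ p) 1 + Complex.I * fderiv ℝ χ (pt δ p) Complex.I) / 2 * w δ p)
        (𝓝[>] 0)
        (𝓝 (c * ∫ z in Ω, (fderiv ℝ χ z 1 + Complex.I * fderiv ℝ χ z Complex.I) / 2 * g z)))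
    (ψ : ℂ → ℂ) (hψ : Continuous ψ) (hψs : HasCompactSupport ψ) (hψΩ : tsupport ψ ⊆ Ω) :
    Tendsto (fun δ : ℝ => ∑ p ∈ E δ, ψ (pt δ p) * w δ p) (𝓝[>] 0) (𝓝 (c * ∫ z, ψ z * g z)) :=
  bumpSynthesis stub_bumpPrimitive stub_bumpApproximation Ω hΩ hΩb a ha g hg hgi c E pt w hnear
    hmass hdbar ψ hψ hψs hψΩ

/-! ### Composition -/

/-- The root `D.pt 0` is a frontier point, hence not in the (open) carrier. [folklore] -/
theorem pt_not_mem_carrier (D : DobrushinDomain) (i : Fin 2) : D.pt i ∉ D.carrier := by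
  intro h
  have hf : D.pt i ∈ frontier D.carrier := D.boundary_mem_frontier _
  rw [D.isOpen.frontier_eq] at hf
  exact hf.2 h

/-- **The line closes the crux.** `HexObservableLimitR` from the three SAW stubs, the landed helpers and the
explicit-bump synthesis, with `c = 6 c'`. -/
theorem HexObservableLimitR_of :
    Summit.CriticalPhenomena.SAWScalingLimit.Theses.SAWDefectDecoherence.HexObservableLimitR := by
  obtain ⟨c', hc', hBF⟩ := stub_boundaryFlux
  refine ⟨6 * c', mul_ne_zero (by norm_num) hc', ?_⟩
  intro D ρ Λ m a b Φ L Lb ψ F hρ hflat hdisc hexh ha hb hΦa hΦb hL hexpL hLb hψc hψs hψΩ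
  -- the inputs of the line, instantiated on this admissible family
  have hMB := stub_massBound D ρ Λ m a b Φ L Lb hρ hflat hdisc hexh ha hb hΦa hΦb hL hexpL hLb
  have hTN := stub_twistNull D ρ Λ m a b Φ L Lb hρ hflat hdisc hexh ha hb hΦa hΦb hL hexpL hLb
  have hBF' := hBF D ρ Λ m a b Φ L Lb hρ hflat hdisc hexh ha hb hΦa hΦb hL hexpL hLb
  have hGL := stub_greenLimit D Λ a b L Lb (hdisc.mono fun δ h => ⟨h.1, h.2.1⟩) hMB hTN c' hBF'
  have hgi := stub_densityIntegrable D ρ Φ L Lb hρ hflat hΦa hΦb hL hexpL hLb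
  have hpt : D.pt 0 ∉ D.carrier := pt_not_mem_carrier D 0
  have hg : ContinuousOn (fun z => Complex.exp ((5 / 8 : ℂ) * (L z - Lb))) D.carrier :=
    Complex.continuous_exp.comp_continuousOn (continuousOn_const.mul (hL.sub continuousOn_const))
  -- the finitely supported normalised measures on black→white interior pairs
  set E : ℝ → Finset (HexVertex × HexVertex) := fun δ =>
    (((Λ δ).filter fun v => v.2 = 0) ×ˢ Λ δ).filter (fun p => hexGraph.Adj p.1 p.2) with hE
  set pt : ℝ → HexVertex × HexVertex → ℂ := fun δ p => (δ : ℂ) * hexMidpoint s(p.1, p.2) with hpt'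
  set w : ℝ → HexVertex × HexVertex → ℂ := fun δ p =>
    (δ : ℂ) ^ 2 * F δ s(p.1, p.2) / F δ (b δ) with hw
  have hδpos : ∀ᶠ δ : ℝ in 𝓝[>] 0, 0 < δ := eventually_mem_nhdsWithin
  -- support within `δ` of `Ω`
  have hnear : ∀ᶠ δ : ℝ in 𝓝[>] 0, ∀ p ∈ E δ, infDist (pt δ p) D.carrier ≤ δ := by
    filter_upwards [hdisc, hδpos] with δ hd hδ
    intro p hp
    rw [hE, mem_pairFinset] at hp
    obtain ⟨h1, -, -, hadj⟩ := hp
    have hin : (δ : ℂ) * hexCenter p.1 ∈ D.carrier := hd.2.2.2.2.2.1 p.1 h1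
    calc infDist (pt δ p) D.carrier ≤ dist (pt δ p) ((δ : ℂ) * hexCenter p.1) :=
          infDist_le_dist_of_mem hin
      _ ≤ δ / 2 := dist_mid_center_le hδ.le hadj
      _ ≤ δ := by linarith
  -- the mass bound in the synthesis' format
  have hmass : ∀ K : Set ℂ, IsCompact K → D.pt 0 ∉ K → ∃ C : ℝ, ∀ᶠ δ : ℝ in 𝓝[>] 0,
      ∑ p ∈ E δ, K.indicator (fun _ => ‖w δ p‖) (pt δ p) ≤ C := by
    intro K hK hKa
    obtain ⟨C, hC⟩ := hMB K hK hKa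
    refine ⟨C, hC.mono fun δ hδ => ?_⟩
    rw [hE, sum_pairFinset_eq]
    convert hδ using 1
  -- the `∂̄`-moments
  have hdbar : ∀ χ : ℂ → ℂ, ContDiff ℝ 3 χ → HasCompactSupport χ → D.pt 0 ∉ tsupport χ →
      Tendsto (fun δ : ℝ => ∑ p ∈ E δ,
        (fderiv ℝ χ (pt δ p) 1 + Complex.I * fderiv ℝ χ (pt δ p) Complex.I) / 2 * w δ p)
        (𝓝[>] 0)
        (𝓝 ((6 * c') * ∫ z in D.carrier,
          (fderiv ℝ χ z 1 + Complex.I * fderiv ℝ χ z Complex.I) / 2 *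
            Complex.exp ((5 / 8 : ℂ) * (L z - Lb)))) := by
    intro χ hχ hχs hχa
    exact hGL χ hχ hχs hχa
  have key := bumpSynthesis_of_stubs D.carrier D.isOpen D.isBounded (D.pt 0) hpt
    (fun z => Complex.exp ((5 / 8 : ℂ) * (L z - Lb))) hg hgi (6 * c') E pt w hnear hmass hdbar
    ψ hψc hψs hψΩ
  have hre := stub_reindex D Λ a b ψ hexh hψc hψs hψΩ
  refine key.congr' ?_
  filter_upwards [hre] with δ hδ
  exact hδ.symm

/-- **The line closes the crux for route SAWPhaseRetrieval too.** The SAWPhaseRetrieval copy of the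
crux is the byte-identical proposition (one shared item stmt-CriticalPhenomena-14003). -/
theorem HexObservableLimitR_of_phaseRetrieval :
    Summit.CriticalPhenomena.SAWScalingLimit.Theses.SAWPhaseRetrieval.HexObservableLimitR :=
  HexObservableLimitR_of


end Summit.CriticalPhenomena.SAWScalingLimit.Cruxes.HexObservableLimitR.ExplicitBump

end
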